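import Summits.AtomisticToContinuum.FouriersLaw.Theses.EmbeddedDrudeMourre
import Literature.MathematicalPhysics.KineticTheory.LangevinChainKernel
import Literature.MathematicalPhysics.KineticTheory.LangevinChainGibbs
import Literature.MathematicalPhysics.KineticTheory.InfiniteChainSuperstableDynamics
import Literature.MathematicalPhysics.KineticTheory.InfiniteChainInvariantStates

/-!
# Line `fekete-at-every-laplace-frequency` for crux `AbelThermodynamicLimit` (stmt-AtomisticToContinuum-12596)

Crux (route `EmbeddedDrudeMourre`, rank 4; decl
`Summit.AtomisticToContinuum.FouriersLaw.Theses.EmbeddedDrudeMourre.AbelThermodynamicLimit`): for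
`P = pinnedChain ω₂ lam β γ` (all `> 0`), under weak-NESS uniqueness `Uniq`, for every `T > 0`: IF an
Abelian Green–Kubo witness `(μT, D, κ)` exists at `T` (DLR Gibbs state, `μT`-preserving infinite-volume
dynamics with absolutely convergent current correlations, `κ > 0`, `T⁻²∫₀^∞ e^{-νt} C_T(t) dt → κ` as
`ν ↓ 0`), THEN some witness `(μT, D, κ)` has `Dn → κ` for every steady family and every response sequence
`Dn N = lim_{δ→0} totalCurrent(μ N (T+δ/2) (T−δ/2))/δ`.

## The line (idea card `Ideas/fekete-at-every-laplace-frequency.md`, triage r1: 3 × pass)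

FEKETE AT EVERY LAPLACE FREQUENCY. The object is the OPEN chain's current resolvent form
`F_N(ν) = ∫₀^∞ e^{-νt} c_N(t) dt`, `c_N(t) = ∫ J·(P_t J) dμ_{N,T}`, `J = Σ_b j_b` (both baths at `T`;
the `c_N` of `StaticAbelianSqueeze` (K)/(R)). The lever is the SIGN LAW (QS): `ν`-uniform
quasi-superadditivity `F_{N+M}(ν) ≥ F_N(ν) + F_M(ν) − C` under concatenation of chains. Fekete turns
"limit" into "supremum": `F_N(ν) ≤ N·K_ν + C` for EVERY `N` at every small `ν`, `K_ν` the bulk Abel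
function; letting `ν ↓ 0` at FIXED `N` through the crux's own witness gives the upper half
`limsup D_N ≤ κ_A` (and the no-overshoot law `(N−1)T²D_N ≤ N T²κ_A + C`); the interchange of `N → ∞`
with `ν ↓ 0` is done by a SIGN, not a rate. The lower half is the one-sided residual (R⁻) "no extensive
DC notch". Stubs (5; `sorry` only there; every signature self-contained over tree declarations):

* `stub_openKuboAbel` (S1, size M–L) — the fixed-`N` OPEN-CHAIN Kubo–Abel identity: VERBATIM the body
  of `StaticAbelianSqueeze.KuboAbelIdentity` (item stmt-AtomisticToContinuum-13419, (K)): under `Uniq`,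
  for every steady family, `T > 0`, `N` and response coefficient `D`, `c_N ∈ L¹(0,∞)` and
  `(N−1)T²D = ∫₀^∞ c_N` (Kundu–Dhar–Narayan). The ONLY place where `0 < γ` and `Uniq` act (Disproof §2a:
  `exists_witness_iff_gamma`, `conclusion_false_gamma_zero`, `not_uniq_gamma_zero`; §4 step (1)).
* `stub_quasiSuperadditivity` (S2, size XL, THE LEVER, rank-2 content of the card) — QS: for `T > 0`
  there are `C ≥ 0`, `ν₀ > 0` with `F_N(ν) + F_M(ν) − C ≤ F_{N+M}(ν)` for all `N, M ≥ 2`, uniformly in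
  `ν ∈ (0, ν₀]`. Regime-blind (holds with `C = 0` in every exact/MD test: kit j006699–6701, j006704,
  triage j012872, j012987); junction-local resolvent surgery of an accretive Θ-reversible generator.
* `stub_fixedFrequencyMatching` (S3, size L–XL) — fixed-`ν` identification of the per-length limit with
  the bulk Abel function, `F_N(ν)/N → Â(ν) := ∫₀^∞ e^{-νt} C_T(t) dt` for `ν ∈ (0, ν₀]`, for witnesses
  with REGULAR state (DLR + shift-invariant + Buttà–Marchioro superstability estimate; triage r1-2
  sharpen "name WHICH witness"): light cone at scale `v/ν` + 1-D ensemble equivalence + canonicity of the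
  Abel functional on regular states (R2 `ae_forall_flow_mem_bmGood`, landed) + regular DLR uniqueness
  (COPP 1978). Disproof §4 step (2). (Existence of `lim_N F_N(ν)/N` is free from QS by Fekete; the
  content is the identification.)
* `stub_noExtensiveDCNotch` (S4, size XL, the shared open core) — (R⁻), ONE-sided, conditional on the
  crux's own witness hypothesis: `∀ ε ∃ ν₀ ∀ ν ∈ (0,ν₀] ∃ N₀ ∀ N ≥ N₀ ∀ᶠ ν' ↓ 0`,
  `F_N(ν) − F_N(ν') ≤ εN` — towards DC the open chain's current noise never sits extensively under
  its value at any small frequency. The lower half of `StaticAbelianSqueeze` (R)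
  stmt-13416 (whose upper half QS makes a corollary); Disproof §4 step (3): here `lam, β > 0` must act
  quantitatively (hydrodynamic-window engines: ContactEchoEpochs W2, escape-deficit CROSSOVER,
  GriffithsLimitExchange, slow-abel-diagonal's anchored late flatness).
* `stub_witnessRegularisation` (S5, size open/M) — VERBATIM the registered stub of the sibling crux
  `GreenKuboContinuation` (line temperature-blind-vitali-hurwitz rev 5): if some witness exists at `T`
  then one with regular state exists. The identification seam every line of this route meets; shared.

`reduction : S1 → S2 → S3 → S4 → S5 → <crux body>` is PROVED below (real analysis: Fekete iteration at
fixed `ν`, `ν ↓ 0` at fixed `N`, the one-sided notch bound, squeeze; axioms standard), and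
`AbelThermodynamicLimit_of : AbelThermodynamicLimit` is the composition applied to the five stubs — the
ONLY theorem of this file whose conclusion is the crux constant (the skeleton audit analyses the first
such theorem it meets and flags Π-typed hypotheses, hence the arrow form concludes the crux BODY and
the by-name theorem is hypothesis-free). The by-product `noOvershoot_of : S1 → S2 → S3 → S5 → …` (no
(R⁻)!) proves the falsifiable fingerprint the triage asked for: `(N−1)T²D_N ≤ N·T²κ' + C` for EVERY
`N ≥ 2` — `HasBoundedResponse`-sharp (Disproof §3 `hasBoundedResponse_of_crux` paid explicitly).
Conversely `noExtensiveDCNotch_of_crux : S1 → S3 → (crux conclusion for a regular witness) → (one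
response sequence exists) → S4's conclusion` is PROVED (`RealAnalysis.notch_of_limit`): modulo the
infrastructure S1 + S3 + S5 (+ item 0717), S2 ∧ S4 ⇒ crux ⇒ S4 — the residual is crux-equivalent, in
particular NOT stronger than the crux (triage r1-2/3 objection to unconditional / ν-uniform residuals).

## Disproof used (`Cruxes/AbelThermodynamicLimit/Disproof.lean`, cdisprove cycle 1 v4; read 2026-08-16)

§2a `exists_witness_iff_gamma` / `tlconv_gamma_zero_false` / `not_uniq_gamma_zero`: read as
"`AbelThermodynamicLimit` is false without routing `γ > 0` through the open-chain side" — honoured: `γ`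
enters only through S1 (Uniq + steady family + response ⇒ Kubo–Abel identity for the `γ`-dependent
kernels `transitionKernel`) and through the `γ`-dependent objects `F_N` of S2–S4; at `γ = 0` the line
degenerates correctly (S1's hypotheses fail, `not_uniq_gamma_zero`). §2b `tlconv_false_of_nonpos` /
`no_witness_of_nonpos`: bookkeeping, every stub carries `0 < T`. §2c `tlconv_harmonic_false` /
`cruxShape_harmonic_iff`: honoured and used as calibration — QS (S2) holds at `lam = β = 0` with `C = 0`
(exact Gaussian jobs) while the Fekete bound is vacuous there because no witness exists (`K_{0⁺} = ∞`);
the witness is consumed at the single step `ν ↓ 0` at fixed `N` (`fekete_abel_upper`, `abel_lower`).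
§1 `crux_iff_pointwise` / `response_unique`: the composition outputs the REGULARISED witness of S5 and
proves `Dn → κ'` for its `κ'` directly for every family (no appeal to pointwise form needed). §3
`hasBoundedResponse_of_crux`: paid early and explicitly by `noOvershoot_of`. §4 `resists` skeleton
(1)/(2)/(3) = S1 / S3 / (S2 ⊕ S4): step (3) is split into a SIGN (S2, regime-blind) plus the one-sided
(R⁻) (S4), where anharmonicity must act quantitatively, as the disprover predicts. No refuted
strengthening, `_false_without_` theorem beyond §2, or landed `Negative/` lemma exists for this crux
(`ledger crux ls`, `ledger negatives --problem AtomisticToContinuum`: none on D_N / 0742 / Abel), so no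
stub is an instance of a landed negative lemma.
-/

noncomputable section

namespace Summit.AtomisticToContinuum.FouriersLaw.Cruxes.AbelThermodynamicLimit.FeketeAtEveryLaplaceFrequency

open MeasureTheory Filter Set Topology
open Literature.MathematicalPhysics.KineticTheory.HeatConduction

/-! ## Real analysis of the line (abstract sequences; no chain objects) -/

namespace RealAnalysis


/-- **Fekete at every Laplace frequency ⇒ upper half** (ideator's lemma, proved). -/
theorem fekete_abel_upper (F : ℕ → ℝ → ℝ) (F0 : ℕ → ℝ) (K : ℝ → ℝ) (C L ν₀ : ℝ) (hν₀ : 0 < ν₀)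
    (hQS : ∀ ν ∈ Ioc (0 : ℝ) ν₀, ∀ N M : ℕ, 2 ≤ N → 2 ≤ M → F N ν + F M ν - C ≤ F (N + M) ν)
    (hlim : ∀ ν ∈ Ioc (0 : ℝ) ν₀, Tendsto (fun N : ℕ => F N ν / N) atTop (𝓝 (K ν)))
    (hK : Tendsto K (𝓝[>] 0) (𝓝 L))
    (hDC : ∀ N : ℕ, 2 ≤ N → Tendsto (F N) (𝓝[>] 0) (𝓝 (F0 N))) :
    ∀ N : ℕ, 2 ≤ N → F0 N ≤ N * L + C := by
  intro N hN
  have hNpos : 0 < N := by omega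
  have hNposR : (0 : ℝ) < N := by exact_mod_cast hNpos
  have key : ∀ ν ∈ Ioc (0 : ℝ) ν₀, F N ν ≤ N * K ν + C := by
    intro ν hν
    have iter : ∀ k : ℕ, 1 ≤ k → (k : ℝ) * F N ν - ((k : ℝ) - 1) * C ≤ F (k * N) ν := by
      intro k hk
      induction k with
      | zero => omega
      | succ k ih =>
        rcases Nat.eq_zero_or_pos k with rfl | hkpos
        · simp
        · have ih' := ih hkpos
          have hkN : 2 ≤ k * N := le_trans hN (Nat.le_mul_of_pos_left N hkpos)
          have hq := hQS ν hν (k * N) N hkN hN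
          have hcast : ((k + 1 : ℕ) : ℝ) = (k : ℝ) + 1 := by push_cast; ring
          have hidx : (k + 1) * N = k * N + N := by ring
          rw [hidx, hcast]
          linarith
    have hmul : Tendsto (fun k : ℕ => k * N) atTop atTop :=
      tendsto_atTop_atTop.2 fun b => ⟨b, fun k hk => le_trans hk (Nat.le_mul_of_pos_right k hNpos)⟩
    have hsub : Tendsto (fun k : ℕ => F (k * N) ν / ((k * N : ℕ) : ℝ)) atTop (𝓝 (K ν)) :=
      (hlim ν hν).comp hmul
    have hRHS : Tendsto (fun k : ℕ => (F N ν - C) / N + C / N / (k : ℝ)) atTop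
        (𝓝 ((F N ν - C) / N + 0)) :=
      tendsto_const_nhds.add (tendsto_const_div_atTop_nhds_zero_nat (C / N))
    have hlow : ∀ᶠ k : ℕ in atTop,
        (F N ν - C) / N + C / N / (k : ℝ) ≤ F (k * N) ν / ((k * N : ℕ) : ℝ) := by
      filter_upwards [eventually_ge_atTop 1] with k hk
      have hkposR : (0 : ℝ) < k := by exact_mod_cast hk
      have h := iter k hk
      have e1 : (F N ν - C) / N + C / N / (k : ℝ) =
          ((k : ℝ) * F N ν - ((k : ℝ) - 1) * C) / ((k * N : ℕ) : ℝ) := by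
        push_cast
        field_simp
        ring
      rw [e1]
      exact div_le_div_of_nonneg_right h (by positivity)
    have hle : (F N ν - C) / N + 0 ≤ K ν := le_of_tendsto_of_tendsto hRHS hsub hlow
    rw [add_zero, div_le_iff₀ hNposR] at hle
    linarith
  have hev : ∀ᶠ ν in 𝓝[>] (0 : ℝ), F N ν ≤ N * K ν + C := by
    filter_upwards [Ioc_mem_nhdsGT hν₀] with ν hν using key ν hν
  have hlimG : Tendsto (fun ν => (N : ℝ) * K ν + C) (𝓝[>] (0 : ℝ)) (𝓝 (N * L + C)) :=
    (hK.const_mul (N : ℝ)).add_const C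
  exact le_of_tendsto_of_tendsto (hDC N hN) hlimG hev

/-- **No extensive DC notch ⇒ lower half.** -/
theorem abel_lower (F : ℕ → ℝ → ℝ) (F0 : ℕ → ℝ) (K : ℝ → ℝ) (L ν₂ : ℝ) (hν₂ : 0 < ν₂)
    (hlim : ∀ ν ∈ Ioc (0 : ℝ) ν₂, Tendsto (fun N : ℕ => F N ν / N) atTop (𝓝 (K ν)))
    (hK : Tendsto K (𝓝[>] 0) (𝓝 L))
    (hDC : ∀ N : ℕ, Tendsto (F N) (𝓝[>] 0) (𝓝 (F0 N)))
    (hNotch : ∀ ε : ℝ, 0 < ε → ∃ ν₀ : ℝ, 0 < ν₀ ∧ ∀ ν : ℝ, 0 < ν → ν ≤ ν₀ →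
      ∃ N₀ : ℕ, ∀ N : ℕ, N₀ ≤ N → ∀ᶠ ν' in 𝓝[>] (0 : ℝ), F N ν - F N ν' ≤ ε * N) :
    ∀ ε : ℝ, 0 < ε → ∀ᶠ N : ℕ in atTop, (L - ε) * N ≤ F0 N := by
  intro ε hε
  have hε3 : 0 < ε / 3 := by positivity
  obtain ⟨ν₀, hν₀, hN⟩ := hNotch (ε / 3) hε3
  have hm : 0 < min ν₀ ν₂ := lt_min hν₀ hν₂
  have hKev : ∀ᶠ ν in 𝓝[>] (0 : ℝ), L - ε / 3 < K ν := hK.eventually (lt_mem_nhds (by linarith))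
  obtain ⟨ν, hKν, hνm⟩ : ∃ ν, L - ε / 3 < K ν ∧ ν ∈ Ioc (0 : ℝ) (min ν₀ ν₂) :=
    (hKev.and (Ioc_mem_nhdsGT hm)).exists
  have hν0 : 0 < ν := hνm.1
  have hν₀' : ν ≤ ν₀ := le_trans hνm.2 (min_le_left _ _)
  have hν₂' : ν ∈ Ioc (0 : ℝ) ν₂ := ⟨hν0, le_trans hνm.2 (min_le_right _ _)⟩
  obtain ⟨N₀, hN₀⟩ := hN ν hν0 hν₀'
  -- Step 1: towards DC the form never sits more than `(ε/3)N` under `F N ν`; let `ν' ↓ 0`.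
  have step1 : ∀ N : ℕ, N₀ ≤ N → F N ν - ε / 3 * N ≤ F0 N := by
    intro N hNN
    have hev : ∀ᶠ ν' in 𝓝[>] (0 : ℝ), F N ν - ε / 3 * N ≤ F N ν' :=
      (hN₀ N hNN).mono fun ν' h => by linarith
    exact ge_of_tendsto (hDC N) hev
  -- Step 2: at the fixed frequency `ν`, the per-length limit is `K ν > L - ε/3`.
  have step2 : ∀ᶠ N : ℕ in atTop, (L - 2 * ε / 3) * N ≤ F N ν := by
    have h1 : ∀ᶠ N : ℕ in atTop, L - 2 * ε / 3 < F N ν / N :=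
      (hlim ν hν₂').eventually (lt_mem_nhds (by linarith))
    filter_upwards [h1, eventually_gt_atTop 0] with N h1N hNpos
    have hNposR : (0 : ℝ) < N := by exact_mod_cast hNpos
    rw [lt_div_iff₀ hNposR] at h1N
    linarith
  filter_upwards [step2, eventually_ge_atTop N₀] with N h2 hNN
  have h1 := step1 N hNN
  have e1 : (L - ε) * N = (L - 2 * ε / 3) * N - ε / 3 * N := by ring
  linarith

/-- **The residual is not stronger than the crux**: if the per-length DC values `F0 N / N` DO converge
to `L` (the crux's conclusion, through S1), then with the fixed-frequency limits (S3) and `K → L` the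
one-sided notch bound of S4 holds. So, modulo S1 + S3 (+ S5 and the existence of one response
sequence), S4 is EQUIVALENT to the lower half of the crux. -/
theorem notch_of_limit (F : ℕ → ℝ → ℝ) (F0 : ℕ → ℝ) (K : ℝ → ℝ) (L ν₂ : ℝ) (hν₂ : 0 < ν₂)
    (hlim : ∀ ν ∈ Ioc (0 : ℝ) ν₂, Tendsto (fun N : ℕ => F N ν / N) atTop (𝓝 (K ν)))
    (hK : Tendsto K (𝓝[>] 0) (𝓝 L))
    (hDC : ∀ N : ℕ, Tendsto (F N) (𝓝[>] 0) (𝓝 (F0 N)))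
    (hconv : Tendsto (fun N : ℕ => F0 N / N) atTop (𝓝 L)) :
    ∀ ε : ℝ, 0 < ε → ∃ ν₀ : ℝ, 0 < ν₀ ∧ ∀ ν : ℝ, 0 < ν → ν ≤ ν₀ →
      ∃ N₀ : ℕ, ∀ N : ℕ, N₀ ≤ N → ∀ᶠ ν' in 𝓝[>] (0 : ℝ), F N ν - F N ν' ≤ ε * N := by
  intro ε hε
  have hKev : ∀ᶠ ν in 𝓝[>] (0 : ℝ), K ν < L + ε / 4 := hK.eventually (gt_mem_nhds (by linarith))
  obtain ⟨u, hu, hsub⟩ := mem_nhdsGT_iff_exists_Ioc_subset.1 (hKev.and (Ioc_mem_nhdsGT hν₂))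
  refine ⟨u, hu, fun ν hν0 hνu => ?_⟩
  have hν : K ν < L + ε / 4 ∧ ν ∈ Ioc (0 : ℝ) ν₂ := hsub ⟨hν0, hνu⟩
  have h1 : ∀ᶠ N : ℕ in atTop, F N ν < (L + ε / 2) * N := by
    have h := (hlim ν hν.2).eventually (gt_mem_nhds (show K ν < L + ε / 2 by linarith))
    filter_upwards [h, eventually_gt_atTop 0] with N hN hNpos
    have hNposR : (0 : ℝ) < N := by exact_mod_cast hNpos
    rwa [div_lt_iff₀ hNposR] at hN
  have h2 : ∀ᶠ N : ℕ in atTop, (L - ε / 4) * N < F0 N := by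
    have h := hconv.eventually (lt_mem_nhds (show L - ε / 4 < L by linarith))
    filter_upwards [h, eventually_gt_atTop 0] with N hN hNpos
    have hNposR : (0 : ℝ) < N := by exact_mod_cast hNpos
    rwa [lt_div_iff₀ hNposR] at hN
  obtain ⟨N₀, hN₀⟩ := eventually_atTop.1 (h1.and (h2.and (eventually_gt_atTop 0)))
  refine ⟨N₀, fun N hNN => ?_⟩
  obtain ⟨hF, hF0, hNpos⟩ := hN₀ N hNN
  have hNposR : (0 : ℝ) < N := by exact_mod_cast hNpos
  have hq : 0 < ε / 4 * N := by positivity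
  have h3 : ∀ᶠ ν' in 𝓝[>] (0 : ℝ), F0 N - ε / 4 * N < F N ν' :=
    (hDC N).eventually (lt_mem_nhds (by linarith))
  refine h3.mono fun ν' h => ?_
  have e : (L + ε / 2) * N - ((L - ε / 4) * N - ε / 4 * N) = ε * N := by ring
  linarith

/-- **Squeeze**: a two-sided per-length bound gives the limit of `F0 N / N`. -/
theorem tendsto_div_of_two_sided (F0 : ℕ → ℝ) (L C : ℝ)
    (hup : ∀ N : ℕ, 2 ≤ N → F0 N ≤ N * L + C)
    (hlow : ∀ ε : ℝ, 0 < ε → ∀ᶠ N : ℕ in atTop, (L - ε) * N ≤ F0 N) :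
    Tendsto (fun N : ℕ => F0 N / N) atTop (𝓝 L) := by
  rw [tendsto_order]
  constructor
  · intro a ha
    have hε : 0 < (L - a) / 2 := by linarith
    filter_upwards [hlow _ hε, eventually_gt_atTop 0] with N hN hNpos
    have hNposR : (0 : ℝ) < N := by exact_mod_cast hNpos
    rw [lt_div_iff₀ hNposR]
    have e : (L - (L - a) / 2) * N = a * N + (L - a) / 2 * N := by ring
    have : 0 < (L - a) / 2 * N := by positivity
    linarith
  · intro b hb
    have hC : Tendsto (fun N : ℕ => C / (N : ℝ)) atTop (𝓝 0) :=
      tendsto_const_div_atTop_nhds_zero_nat C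
    have hev : ∀ᶠ N : ℕ in atTop, C / (N : ℝ) < b - L := hC.eventually (gt_mem_nhds (by linarith))
    filter_upwards [hev, eventually_ge_atTop 2] with N hN hN2
    have hNposR : (0 : ℝ) < N := by exact_mod_cast (show 0 < N by omega)
    rw [div_lt_iff₀ hNposR]
    have h := hup N hN2
    have h' : C < (b - L) * N := by rwa [div_lt_iff₀ hNposR] at hN
    have e2 : (b - L) * N = b * N - N * L := by ring
    linarith

/-- From the per-length limit of `(N-1)T² D_N` to the limit of `D_N`. -/
theorem tendsto_response_of_tendsto_div (D : ℕ → ℝ) (T κ : ℝ) (hT : 0 < T)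
    (h : Tendsto (fun N : ℕ => ((N : ℝ) - 1) * T ^ 2 * D N / N) atTop (𝓝 (T ^ 2 * κ))) :
    Tendsto D atTop (𝓝 κ) := by
  have hT2 : (0 : ℝ) < T ^ 2 := by positivity
  have h1 : Tendsto (fun N : ℕ => (N : ℝ) / ((N : ℝ) + (-1))) atTop (𝓝 1) :=
    tendsto_natCast_div_add_atTop (-1)
  have h2 : Tendsto (fun N : ℕ => ((N : ℝ) - 1) * T ^ 2 * D N / N *
      ((N : ℝ) / ((N : ℝ) + (-1)) * (T ^ 2)⁻¹)) atTop (𝓝 (T ^ 2 * κ * (1 * (T ^ 2)⁻¹))) :=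
    h.mul (h1.mul tendsto_const_nhds)
  have e : T ^ 2 * κ * (1 * (T ^ 2)⁻¹) = κ := by
    field_simp
  rw [e] at h2
  refine h2.congr' ?_
  filter_upwards [eventually_ge_atTop 2] with N hN
  have hN2 : (2 : ℝ) ≤ N := by exact_mod_cast hN
  have hN1 : (N : ℝ) + (-1) ≠ 0 := by
    intro h0
    linarith
  have hN0 : (N : ℝ) ≠ 0 := by
    intro h0
    linarith
  field_simp
  ring

/-- The Laplace transform of an `L¹(0,∞)` function is right-continuous at `0`. -/
theorem tendsto_laplace_zero {c : ℝ → ℝ} (hc : IntegrableOn c (Ioi 0)) :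
    Tendsto (fun ν : ℝ => ∫ t in Ioi (0 : ℝ), Real.exp (-(ν * t)) * c t) (𝓝[>] 0)
      (𝓝 (∫ t in Ioi (0 : ℝ), c t)) := by
  have key : Tendsto (fun ν : ℝ => ∫ t in Ioi (0 : ℝ), Real.exp (-(ν * t)) * c t) (𝓝[>] 0)
      (𝓝 (∫ t in Ioi (0 : ℝ), Real.exp (-(0 * t)) * c t)) := by
    apply tendsto_integral_filter_of_dominated_convergence (fun t => |c t|)
    · refine Eventually.of_forall fun ν => ?_
      have hcont : Continuous fun t : ℝ => Real.exp (-(ν * t)) := by fun_prop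
      exact hcont.aestronglyMeasurable.mul hc.aestronglyMeasurable
    · filter_upwards [self_mem_nhdsWithin] with ν hν
      refine (ae_restrict_mem measurableSet_Ioi).mono fun t ht => ?_
      have hν' : (0 : ℝ) < ν := hν
      have ht' : (0 : ℝ) < t := ht
      rw [Real.norm_eq_abs, abs_mul, Real.abs_exp]
      have hle : Real.exp (-(ν * t)) ≤ 1 := Real.exp_le_one_iff.mpr (by nlinarith)
      calc Real.exp (-(ν * t)) * |c t| ≤ 1 * |c t| := by gcongr
        _ = |c t| := one_mul _
    · exact hc.abs
    · refine Eventually.of_forall fun t => ?_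
      have hcont : Continuous fun ν : ℝ => Real.exp (-(ν * t)) * c t := by fun_prop
      exact (hcont.tendsto 0).mono_left nhdsWithin_le_nhds
  simpa using key

end RealAnalysis


/-! ## Proof-side shorthand (never used inside a stub signature: a Lines file is not importable) -/

/-- Total bond current `J = Σ_b j_b` of the `N`-chain. -/
def Jtot (ω₂ lam β γ : ℝ) (N : ℕ) (z : PhaseSpace N) : ℝ :=
  ∑ i : Fin N, (pinnedChain ω₂ lam β γ).bondCurrent N i z

/-- Open-chain equilibrium current autocorrelation `c_N(t) = ∫ J · (P_t J) dμ_{N,T}` (both baths at `T`;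
the constructed kernels `transitionKernel`, the product Gibbs measure `gibbsMeasure`; verbatim the `c_N`
of `StaticAbelianSqueeze` (K)/(R)). -/
def cN (ω₂ lam β γ T : ℝ) (N : ℕ) (t : ℝ) : ℝ :=
  ∫ z, Jtot ω₂ lam β γ N z *
      (∫ y, Jtot ω₂ lam β γ N y ∂((pinnedChain ω₂ lam β γ).transitionKernel N T T t.toNNReal z))
    ∂((pinnedChain ω₂ lam β γ).gibbsMeasure N T)

/-- The current resolvent form `F_N(ν) = ∫₀^∞ e^{-νt} c_N(t) dt = Re⟨J,(ν − L_N)⁻¹J⟩_{L²(μ_{N,T})}`. -/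
def FN (ω₂ lam β γ T : ℝ) (N : ℕ) (ν : ℝ) : ℝ :=
  ∫ t in Ioi (0 : ℝ), Real.exp (-(ν * t)) * cN ω₂ lam β γ T N t

/-! ## Registered stubs (the lemmas of the line; `sorry` only here) -/

/-- **Stub S1 — `stub_openKuboAbel`: the fixed-`N` open-chain Kubo–Abel identity (K)** (size M–L;
VERBATIM the body of `Summit.AtomisticToContinuum.FouriersLaw.Theses.StaticAbelianSqueeze.KuboAbelIdentity`,
item stmt-AtomisticToContinuum-13419 — it closes when that item closes, and conversely). Under weak-NESS
uniqueness, for every steady family, `T > 0`, `N` and every response coefficient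
`D = lim_{δ→0,δ≠0} totalCurrent(μ N (T+δ/2) (T−δ/2))/δ`: `t ↦ c_N(t)` is integrable on `(0,∞)` and
`(N−1)·T²·D = ∫₀^∞ c_N(t) dt` (Kundu–Dhar–Narayan open-system Green–Kubo, arXiv:0809.4543 eqs. (8)–(15);
ReyBellet2003 Rem. 4.4 (56); `N = 0, 1`: both sides vanish). Content: NESS = invariant law of the
constructed semigroup (FP-identification half of stmt-0741), differentiability in `δ` with the exchange
`δ → 0` / `t → ∞` (weighted spectral gap, CuneoEckmannHairerReyBellet2018 (2.5)), KDN's Novikov /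
time-reversal steps for polynomially unbounded `J`. This is where `0 < γ` and `Uniq` enter the line
(Disproof §2a). Why it might fail: only through infrastructure (kernel/semigroup identification); the
identity itself is exact linear response (checked to 1e-14 in the Gaussian-closed members, triage
j012872/j012987). Sources: KunduDharNarayan2009, ReyBellet2003, CuneoEckmannHairerReyBellet2018,
BonettoLebowitzReyBellet2000 §6.3 (35). -/
theorem stub_openKuboAbel :
    ∀ ω₂ lam β γ : ℝ, 0 < ω₂ → 0 < lam → 0 < β → 0 < γ → (∀ (N : ℕ) (T_L T_R : ℝ), 0 < T_L → 0 < T_R → ∀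
      μ ν : MeasureTheory.Measure
      (Literature.MathematicalPhysics.KineticTheory.HeatConduction.PhaseSpace N),
      (Literature.MathematicalPhysics.KineticTheory.HeatConduction.pinnedChain ω₂ lam β γ).IsSteadyState
      N T_L T_R μ → (Literature.MathematicalPhysics.KineticTheory.HeatConduction.pinnedChain ω₂ lam β
      γ).IsSteadyState N T_L T_R ν → μ = ν) → ∀ μ : (N : ℕ) → ℝ → ℝ → MeasureTheory.Measure
      (Literature.MathematicalPhysics.KineticTheory.HeatConduction.PhaseSpace N), (∀ (N : ℕ) (T_L T_R :
      ℝ), 0 < T_L → 0 < T_R → (Literature.MathematicalPhysics.KineticTheory.HeatConduction.pinnedChain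
      ω₂ lam β γ).IsSteadyState N T_L T_R (μ N T_L T_R)) → ∀ T : ℝ, 0 < T → ∀ N : ℕ, ∀ D : ℝ,
      Filter.Tendsto (fun δ : ℝ =>
      (Literature.MathematicalPhysics.KineticTheory.HeatConduction.pinnedChain ω₂ lam β γ).totalCurrent
      (μ N (T + δ / 2) (T - δ / 2)) / δ) (nhdsWithin 0 {(0 : ℝ)}ᶜ) (nhds D) →
    let J : Literature.MathematicalPhysics.KineticTheory.HeatConduction.PhaseSpace N → ℝ := fun z => ∑ i : Fin N, (Literature.MathematicalPhysics.KineticTheory.HeatConduction.pinnedChain ω₂ lam β γ).bondCurrent N i z;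
    MeasureTheory.IntegrableOn (fun t : ℝ => ∫ z, J z * (∫ y, J y
      ∂((Literature.MathematicalPhysics.KineticTheory.HeatConduction.pinnedChain ω₂ lam β
      γ).transitionKernel N T T t.toNNReal z))
      ∂((Literature.MathematicalPhysics.KineticTheory.HeatConduction.pinnedChain ω₂ lam β
      γ).gibbsMeasure N T)) (Set.Ioi 0) ∧ ((N:ℝ) - 1) * T ^ 2 * D = ∫ t in Set.Ioi (0:ℝ), ∫ z, J z * (∫
      y, J y ∂((Literature.MathematicalPhysics.KineticTheory.HeatConduction.pinnedChain ω₂ lam β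
      γ).transitionKernel N T T t.toNNReal z))
      ∂((Literature.MathematicalPhysics.KineticTheory.HeatConduction.pinnedChain ω₂ lam β
      γ).gibbsMeasure N T) := by
  sorry

/-- **Stub S2 — `stub_quasiSuperadditivity`: the SIGN LAW (QS), the line's lever** (size XL; rank-2
content of the card; unproved, survived every cheap attack). For `P = pinnedChain ω₂ lam β γ` (all `> 0`)
and `T > 0` there are `C ≥ 0` and `ν₀ > 0` such that for all `ν ∈ (0, ν₀]` and `N, M ≥ 2`:
`F_N(ν) + F_M(ν) − C ≤ F_{N+M}(ν)`, where `F_N(ν) = ∫₀^∞ e^{-νt} c_N(t) dt` is the Laplace-resolved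
equilibrium total-current noise of the OPEN `N`-chain (both baths at `T`). Joining two chains (delete the
two inner contacts, add one anharmonic bond) never destroys more than one contact's worth of
low-frequency current noise. Proof idea (card §Why it bites (2)): `F_N(ν) = Re⟨J,(ν−L_N)⁻¹J⟩` is a
quadratic form of the resolvent of an accretive, Θ-reversible generator; along the junction
interpolation `s ↦ L_s` the second resolvent identity gives an exact surgery formula every term of which
pairs the corrector `u_s = (ν−L_s)⁻¹J_s` with an operator supported AT THE JUNCTION (OU dissipation of
the odd/even parts at the two inner sites, junction Liouvillian pairing, Gibbs reweighting) — no bulk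
estimate; bound the junction terms by BernardinOlla2011 §6 accretive variational formulas. Regime check:
ballistic margin `+2c/ν`, diffusive bounded defect (Robin-contact fluctuating hydrodynamics, triage E2),
localised bounded; exact tests C = 0: harmonic γ ∈ {0.2,1,5} (kit j006699/6700/6701), anharmonic MD
N ≤ 32 (j006704), velocity-flip diffusive/crossover N+M ≤ 128 (triage j012872, j012987: 5670/5670
defects > 0). Why it might fail: an extensive low-frequency noise deficit created by removing two
contacts in the genuinely nonlinear diffusive regime (N = 64…512, mean free path ≪ N) — the scheduled MD
falsifier; or `C` forced to grow with `1/ν` by a contact boundary layer of width `√(D/ν)` (cancels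
exactly at the linear-FH level, triage r1-1 E2). Sources: KunduDharNarayan2009, BernardinOlla2011
(arXiv:1105.0493 §6), BonettoLebowitzReyBellet2000, triage TRIAGE-r1-1/2/3. -/
theorem stub_quasiSuperadditivity :
    ∀ ω₂ lam β γ : ℝ, 0 < ω₂ → 0 < lam → 0 < β → 0 < γ → ∀ T : ℝ, 0 < T →
    let F : ℕ → ℝ → ℝ := fun N ν =>
      MeasureTheory.integral (MeasureTheory.volume.restrict (Set.Ioi (0:ℝ))) (fun t : ℝ =>
        Real.exp (-(ν * t)) *
          ∫ z, (∑ i : Fin N, (Literature.MathematicalPhysics.KineticTheory.HeatConduction.pinnedChain ω₂ lam β γ).bondCurrent N i z) *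
            (∫ y, (∑ i : Fin N, (Literature.MathematicalPhysics.KineticTheory.HeatConduction.pinnedChain ω₂ lam β γ).bondCurrent N i y) ∂((Literature.MathematicalPhysics.KineticTheory.HeatConduction.pinnedChain ω₂ lam β γ).transitionKernel N T T t.toNNReal z))
            ∂((Literature.MathematicalPhysics.KineticTheory.HeatConduction.pinnedChain ω₂ lam β γ).gibbsMeasure N T));
    ∃ C ν₀ : ℝ, 0 ≤ C ∧ 0 < ν₀ ∧ ∀ ν : ℝ, 0 < ν → ν ≤ ν₀ → ∀ N M : ℕ, 2 ≤ N → 2 ≤ M → F N ν + F M ν - C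
      ≤ F (N + M) ν := by
  sorry

/-- **Stub S3 — `stub_fixedFrequencyMatching`: fixed-frequency identification for REGULAR witnesses**
(size L–XL; Disproof §4 step (2)). For `P` (all `> 0`), `T > 0` and every Abelian Green–Kubo witness
`(μT, D, κ)` whose STATE is regular — DLR Gibbs at `T`, shift-invariant, with Buttà–Marchioro's
superstability estimate (2.3) — (dynamics `D` arbitrary `μT`-preserving with absolutely convergent
correlations; `κ > 0` and the Abel limit as in the crux): there is `ν₀ > 0` such that for every
`ν ∈ (0, ν₀]` the per-length open-chain form converges to the bulk Abel function at the SAME frequency,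
`F_N(ν)/N → Â(ν) := ∫₀^∞ e^{-νt} C_T(t) dt`, `C_T = D.currentCorrelation μT`. Content: (a) existence of
`lim_N F_N(ν)/N` is FREE from QS (Fekete) — the stub's content is the identification; (b) at fixed
`ν > 0` only times `≲ 1/ν` matter (`|c_N(t)| ≤ c_N(0) = O(N)`, `e^{-νt}` tail), so by an open-chain
covariance light cone (almost-linear cone of ButtaMarchioro2016 Thm 2.2 — PROVED in tree for the
infinite chain, `ButtaMarchioro2016_thm22_chain_holds`; the OPEN twin with OU ends and the covariance
form are to be derived) only `O((v/ν) log N)` bonds feel a contact, each contributing `O(ν⁻¹)`: `o(N)`;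
(c) interior bonds see the infinite-volume dynamics in the 1-D Gibbs state up to ensemble-equivalence
errors (free-end finite-volume Gibbs marginals vs the shift-invariant DLR state: transfer operator,
exponential mixing); (d) canonicity: for a regular state every preserving dynamics agrees `μT`-a.e. with
the BM flow (landed R2 `OscillatorChain.ae_forall_flow_mem_bmGood_pinnedChain` + `stub_canonicalSeed*`
theorems of Theorems/EmbeddedDrudeMourreGreenKuboContinuationCanonicalSeed*.lean) and regular DLR states
are unique (Dobrushin 1974 / Cassandro–Olivieri–Pellegrinotti–Presutti 1978; the sibling's registered
`stub_regularDLRUnique`), so `Â` is THE bulk function. Restricting to regular states answers triage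
r1-2's sharpen ("IsChainGibbsMeasure is bare DLR; name WHICH witness"). Why it might fail: only through
(b) for the quartic coupling (BCDM 2007 doi:10.1007/s10955-007-9278-0 is harmonic coupling) or a
non-tempered surprise in (d); the statement is false for exotic non-regular DLR witnesses, which is why
they are excluded here and handled by S5. Sources: ButtaMarchioro2016 (arXiv:1602.01294),
BonettoLebowitzReyBellet2000 §7 (35)–(37), LepriLiviPoliti2003, KunduDharNarayan2009, COPP1978. -/
theorem stub_fixedFrequencyMatching :
    ∀ ω₂ lam β γ : ℝ, 0 < ω₂ → 0 < lam → 0 < β → 0 < γ → ∀ T : ℝ, 0 < T → ∀ (μT : MeasureTheory.Measure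
      Literature.MathematicalPhysics.KineticTheory.HeatConduction.ChainConfig) (D :
      Literature.MathematicalPhysics.KineticTheory.HeatConduction.InfiniteChainDynamics
      (Literature.MathematicalPhysics.KineticTheory.HeatConduction.pinnedChain ω₂ lam β γ)) (κ : ℝ),
      (Literature.MathematicalPhysics.KineticTheory.HeatConduction.pinnedChain ω₂ lam β
      γ).IsChainGibbsMeasure T μT →
      Literature.MathematicalPhysics.KineticTheory.HeatConduction.IsShiftInvariant μT →
      (Literature.MathematicalPhysics.KineticTheory.HeatConduction.pinnedChain ω₂ lam β
      γ).HasSuperstabilityEstimate μT → D.PreservesMeasure μT → (∀ t : ℝ, D.HasAbsConvergentCorrelation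
      μT t) → 0 < κ → Filter.Tendsto (fun ν : ℝ => (T ^ 2)⁻¹ * MeasureTheory.integral
      (MeasureTheory.volume.restrict (Set.Ioi (0:ℝ))) (fun t : ℝ => Real.exp (-(ν * t)) *
      D.currentCorrelation μT t)) (nhdsWithin (0:ℝ) (Set.Ioi 0)) (nhds κ) →
    let F : ℕ → ℝ → ℝ := fun N ν =>
      MeasureTheory.integral (MeasureTheory.volume.restrict (Set.Ioi (0:ℝ))) (fun t : ℝ =>
        Real.exp (-(ν * t)) *
          ∫ z, (∑ i : Fin N, (Literature.MathematicalPhysics.KineticTheory.HeatConduction.pinnedChain ω₂ lam β γ).bondCurrent N i z) *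
            (∫ y, (∑ i : Fin N, (Literature.MathematicalPhysics.KineticTheory.HeatConduction.pinnedChain ω₂ lam β γ).bondCurrent N i y) ∂((Literature.MathematicalPhysics.KineticTheory.HeatConduction.pinnedChain ω₂ lam β γ).transitionKernel N T T t.toNNReal z))
            ∂((Literature.MathematicalPhysics.KineticTheory.HeatConduction.pinnedChain ω₂ lam β γ).gibbsMeasure N T));
    ∃ ν₀ : ℝ, 0 < ν₀ ∧ ∀ ν : ℝ, 0 < ν → ν ≤ ν₀ → Filter.Tendsto (fun N : ℕ => F N ν / (N : ℝ))
      Filter.atTop (nhds (MeasureTheory.integral (MeasureTheory.volume.restrict (Set.Ioi (0:ℝ))) (fun t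
      : ℝ => Real.exp (-(ν * t)) * D.currentCorrelation μT t))) := by
  sorry

/-- **Stub S4 — `stub_noExtensiveDCNotch`: the one-sided residual (R⁻)** (size XL; the shared open
core of every line of this crux = the LOWER half of `StaticAbelianSqueeze.UniformAbelianRegularity`
stmt-13416 in two-frequency form; Disproof §4 step (3)). For `P` (all `> 0`) and `T > 0`, IF an Abelian
Green–Kubo witness exists at `T` (verbatim the crux's hypothesis — the statement is CONDITIONAL, so it
asserts nothing about the bulk at temperatures where the bulk does not conduct normally; triage r1-2/3
sharpen on unconditional residuals), THEN for every `ε > 0` there is `ν₀ > 0` such that for every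
`ν ∈ (0, ν₀]`, eventually in `N`, EVENTUALLY AS `ν' ↓ 0`: `F_N(ν) − F_N(ν') ≤ ε·N` — towards DC the
open chain's total-current noise never sits EXTENSIVELY under its value at any small frequency ("no
extensive DC notch"; the `∀ᶠ ν'` form mentions no limit, so no `L¹`/Bochner junk can enter, and it is
exactly what the composition consumes: with S1, `F_N(ν) − (N−1)T²D_N ≤ εN`; given S1 + S3 + S5 and a
response sequence it is EQUIVALENT to the crux's lower half `liminf_N D_N ≥ κ`, so it is not stronger
than the crux — triage r1-1 E3 `LateFlatnessResidual`, one-sided). One-sided: the converse inequality (no extensive DC excess) is a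
COROLLARY of QS + S3 (Fekete), which is the point of the line. Response-free (no `Uniq`, no `D_N`). Phenomenology: in the diffusive
regime the notch has depth `O(1)` per contact (`F_N(0⁺) = T²κ(N−1) − O(1)` vs `F_N(ν)/N = T²κ + O(1/N)`
above the Thouless frequency; exact in the velocity-flip chain, triage j012987 N2: anchored notch
`O(1/N)`; Robin-contact fluctuating hydrodynamics: deficit `2κ²T²/G` per contact, bounded); it is the
sub-Thouless range where the corrector `u_ν` is predominantly EVEN (`dF_N/dν = ‖u_e‖² − ‖u_o‖²`,
reflection identity) and the storage-to-dissipation identity `F_N(ν) = ν‖u_ν‖² + γTΣ_e‖∂_{p_e}u_ν‖²`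
frames it. Engines: ContactEchoEpochs W2, escape-deficit CROSSOVER, GriffithsLimitExchange,
slow-abel-diagonal's `LateFlatnessResidual` (triage E3, crux-equivalent modulo (K) + matching). Why it
might fail: contacts suppressing DC noise extensively — an `O(N)`-deep sub-Thouless notch from slow
hydrodynamic/breather modes of the OPEN chain (L² gap ~ N⁻³, BeckerMenegaki2022; Dhar2008 §2.2 open vs
closed scaling); this is `HasBoundedResponse`-class content (barrier FixedLengthNoConductivityControl)
where `lam, β > 0` must act quantitatively. Sources: BonettoLebowitzReyBellet2000, BeckerMenegaki2022,
KunduDharNarayan2009, Dhar2008, decl Literature.Barriers.AtomisticToContinuum.HasBoundedResponse. -/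
theorem stub_noExtensiveDCNotch :
    ∀ ω₂ lam β γ : ℝ, 0 < ω₂ → 0 < lam → 0 < β → 0 < γ → ∀ T : ℝ, 0 < T → (∃ (μT : MeasureTheory.Measure
      Literature.MathematicalPhysics.KineticTheory.HeatConduction.ChainConfig) (D :
      Literature.MathematicalPhysics.KineticTheory.HeatConduction.InfiniteChainDynamics
      (Literature.MathematicalPhysics.KineticTheory.HeatConduction.pinnedChain ω₂ lam β γ)) (κ : ℝ),
      (Literature.MathematicalPhysics.KineticTheory.HeatConduction.pinnedChain ω₂ lam β
      γ).IsChainGibbsMeasure T μT ∧ D.PreservesMeasure μT ∧ (∀ t : ℝ, D.HasAbsConvergentCorrelation μT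
      t) ∧ 0 < κ ∧ Filter.Tendsto (fun ν : ℝ => (T ^ 2)⁻¹ * MeasureTheory.integral
      (MeasureTheory.volume.restrict (Set.Ioi (0:ℝ))) (fun t : ℝ => Real.exp (-(ν * t)) *
      D.currentCorrelation μT t)) (nhdsWithin (0:ℝ) (Set.Ioi 0)) (nhds κ)) →
    let F : ℕ → ℝ → ℝ := fun N ν =>
      MeasureTheory.integral (MeasureTheory.volume.restrict (Set.Ioi (0:ℝ))) (fun t : ℝ =>
        Real.exp (-(ν * t)) *
          ∫ z, (∑ i : Fin N, (Literature.MathematicalPhysics.KineticTheory.HeatConduction.pinnedChain ω₂ lam β γ).bondCurrent N i z) *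
            (∫ y, (∑ i : Fin N, (Literature.MathematicalPhysics.KineticTheory.HeatConduction.pinnedChain ω₂ lam β γ).bondCurrent N i y) ∂((Literature.MathematicalPhysics.KineticTheory.HeatConduction.pinnedChain ω₂ lam β γ).transitionKernel N T T t.toNNReal z))
            ∂((Literature.MathematicalPhysics.KineticTheory.HeatConduction.pinnedChain ω₂ lam β γ).gibbsMeasure N T));
    ∀ ε : ℝ, 0 < ε → ∃ ν₀ : ℝ, 0 < ν₀ ∧ ∀ ν : ℝ, 0 < ν → ν ≤ ν₀ → ∃ N₀ : ℕ, ∀ N : ℕ, N₀ ≤ N →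
      Filter.Eventually (fun ν' : ℝ => F N ν - F N ν' ≤ ε * (N : ℝ)) (nhdsWithin (0:ℝ) (Set.Ioi 0)) := by
  sorry

/-- **Stub S5 — `stub_witnessRegularisation`: the identification seam** (size open/M; VERBATIM the
registered stub `stub_witnessRegularisation` of the sibling crux `GreenKuboContinuation`, line
temperature-blind-vitali-hurwitz rev 5 — shared, lands once for both). For `P` (all `> 0`) and `T > 0`:
if SOME Abelian Green–Kubo witness exists at `T` (verbatim the crux's clause: ANY DLR state, ANY
preserving dynamics with absolutely convergent correlations, `κ > 0`, the Abel limit) then a witness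
whose STATE is regular (shift-invariant DLR state with BM's superstability estimate; dynamics arbitrary)
exists at `T`. This is the ONLY place where the crux's witness hypothesis is consumed as an existence
statement; S3 then works with the regular witness, and the composition outputs it. Content / why it
might fail (sibling wave-1 analysis): identifying an arbitrary witness needs DLR uniqueness among ALL
states (false-prone: non-tempered DLR states exist already for the harmonic chain) or a temperedness
theorem for states carrying a conducting preserved dynamics; the statement asks less (only that SOME
regular witness exists whenever some witness exists) and is implied by "the canonical pair is a witness
at every witnessed `T`"; it holds trivially if the corner items are ever retyped to deliver regular
witnesses. No cheap refutation: killing it needs a conducting exotic pair at a `T` where the canonical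
pair does not conduct. Sources: Dobrushin1974, CassandroOlivieriPellegrinottiPresutti1978,
ButtaMarchioro2016, Theorems/EmbeddedDrudeMourreGreenKuboContinuationCanonicalSeed*.lean. -/
theorem stub_witnessRegularisation :
    ∀ ω₂ lam β γ : ℝ, 0 < ω₂ → 0 < lam → 0 < β → 0 < γ → ∀ T : ℝ, 0 < T → (∃ (μT : MeasureTheory.Measure
      Literature.MathematicalPhysics.KineticTheory.HeatConduction.ChainConfig) (D' :
      Literature.MathematicalPhysics.KineticTheory.HeatConduction.InfiniteChainDynamics
      (Literature.MathematicalPhysics.KineticTheory.HeatConduction.pinnedChain ω₂ lam β γ)) (κ : ℝ),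
      (Literature.MathematicalPhysics.KineticTheory.HeatConduction.pinnedChain ω₂ lam β
      γ).IsChainGibbsMeasure T μT ∧ D'.PreservesMeasure μT ∧ (∀ t : ℝ, D'.HasAbsConvergentCorrelation μT
      t) ∧ 0 < κ ∧ Filter.Tendsto (fun ν : ℝ => (T ^ 2)⁻¹ * MeasureTheory.integral
      (MeasureTheory.volume.restrict (Set.Ioi (0:ℝ))) (fun t : ℝ => Real.exp (-(ν * t)) *
      D'.currentCorrelation μT t)) (nhdsWithin (0:ℝ) (Set.Ioi 0)) (nhds κ)) → ∃ (μT :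
      MeasureTheory.Measure Literature.MathematicalPhysics.KineticTheory.HeatConduction.ChainConfig) (D'
      : Literature.MathematicalPhysics.KineticTheory.HeatConduction.InfiniteChainDynamics
      (Literature.MathematicalPhysics.KineticTheory.HeatConduction.pinnedChain ω₂ lam β γ)) (κ : ℝ),
      (Literature.MathematicalPhysics.KineticTheory.HeatConduction.pinnedChain ω₂ lam β
      γ).IsChainGibbsMeasure T μT ∧
      Literature.MathematicalPhysics.KineticTheory.HeatConduction.IsShiftInvariant μT ∧
      (Literature.MathematicalPhysics.KineticTheory.HeatConduction.pinnedChain ω₂ lam β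
      γ).HasSuperstabilityEstimate μT ∧ D'.PreservesMeasure μT ∧ (∀ t : ℝ,
      D'.HasAbsConvergentCorrelation μT t) ∧ 0 < κ ∧ Filter.Tendsto (fun ν : ℝ => (T ^ 2)⁻¹ *
      MeasureTheory.integral (MeasureTheory.volume.restrict (Set.Ioi (0:ℝ))) (fun t : ℝ => Real.exp (-(ν
      * t)) * D'.currentCorrelation μT t)) (nhdsWithin (0:ℝ) (Set.Ioi 0)) (nhds κ)
 := by
  sorry

/-! ## The composition (real proof, no `sorry`) -/

/-- **`reduction` — the stubs imply the crux** (conclusion = the BODY of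
`EmbeddedDrudeMourre.AbelThermodynamicLimit`, verbatim; `AbelThermodynamicLimit_of` below restates it by
name). Proof: regularise the witness (S5) and OUTPUT it; for a steady family `μ` with response sequence
`Dn`: S1 gives `c_N ∈ L¹` and `∫₀^∞ c_N = (N−1)T²Dn N`, hence `F_N(ν') → (N−1)T²Dn N` as `ν' ↓ 0`
(dominated convergence, `RealAnalysis.tendsto_laplace_zero`); S2 + S3 + the witness's Abel limit give
the upper bound `(N−1)T²Dn N ≤ N·T²κ + C` for every `N ≥ 2` (`RealAnalysis.fekete_abel_upper`: iterate
QS along `k ↦ kN`, divide by `kN`, pass to the per-length limit `Â(ν)` at fixed `ν`, then `ν ↓ 0` at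
fixed `N`); S4 + S3 + S1 give the lower bound `(T²κ − ε)N ≤ (N−1)T²Dn N` eventually
(`RealAnalysis.abel_lower`); squeeze and `N/(N−1) → 1`. -/
theorem reduction
    (hK : 
      ∀ ω₂ lam β γ : ℝ, 0 < ω₂ → 0 < lam → 0 < β → 0 < γ → (∀ (N : ℕ) (T_L T_R : ℝ), 0 < T_L → 0 < T_R →
        ∀ μ ν : MeasureTheory.Measure
        (Literature.MathematicalPhysics.KineticTheory.HeatConduction.PhaseSpace N),
        (Literature.MathematicalPhysics.KineticTheory.HeatConduction.pinnedChain ω₂ lam β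
        γ).IsSteadyState N T_L T_R μ →
        (Literature.MathematicalPhysics.KineticTheory.HeatConduction.pinnedChain ω₂ lam β
        γ).IsSteadyState N T_L T_R ν → μ = ν) → ∀ μ : (N : ℕ) → ℝ → ℝ → MeasureTheory.Measure
        (Literature.MathematicalPhysics.KineticTheory.HeatConduction.PhaseSpace N), (∀ (N : ℕ) (T_L T_R
        : ℝ), 0 < T_L → 0 < T_R →
        (Literature.MathematicalPhysics.KineticTheory.HeatConduction.pinnedChain ω₂ lam β
        γ).IsSteadyState N T_L T_R (μ N T_L T_R)) → ∀ T : ℝ, 0 < T → ∀ N : ℕ, ∀ D : ℝ, Filter.Tendsto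
        (fun δ : ℝ => (Literature.MathematicalPhysics.KineticTheory.HeatConduction.pinnedChain ω₂ lam β
        γ).totalCurrent (μ N (T + δ / 2) (T - δ / 2)) / δ) (nhdsWithin 0 {(0 : ℝ)}ᶜ) (nhds D) →
      let J : Literature.MathematicalPhysics.KineticTheory.HeatConduction.PhaseSpace N → ℝ := fun z => ∑ i : Fin N, (Literature.MathematicalPhysics.KineticTheory.HeatConduction.pinnedChain ω₂ lam β γ).bondCurrent N i z;
      MeasureTheory.IntegrableOn (fun t : ℝ => ∫ z, J z * (∫ y, J y
        ∂((Literature.MathematicalPhysics.KineticTheory.HeatConduction.pinnedChain ω₂ lam β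
        γ).transitionKernel N T T t.toNNReal z))
        ∂((Literature.MathematicalPhysics.KineticTheory.HeatConduction.pinnedChain ω₂ lam β
        γ).gibbsMeasure N T)) (Set.Ioi 0) ∧ ((N:ℝ) - 1) * T ^ 2 * D = ∫ t in Set.Ioi (0:ℝ), ∫ z, J z *
        (∫ y, J y ∂((Literature.MathematicalPhysics.KineticTheory.HeatConduction.pinnedChain ω₂ lam β
        γ).transitionKernel N T T t.toNNReal z))
        ∂((Literature.MathematicalPhysics.KineticTheory.HeatConduction.pinnedChain ω₂ lam β
        γ).gibbsMeasure N T))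
    (hQS : 
      ∀ ω₂ lam β γ : ℝ, 0 < ω₂ → 0 < lam → 0 < β → 0 < γ → ∀ T : ℝ, 0 < T →
      let F : ℕ → ℝ → ℝ := fun N ν =>
        MeasureTheory.integral (MeasureTheory.volume.restrict (Set.Ioi (0:ℝ))) (fun t : ℝ =>
          Real.exp (-(ν * t)) *
            ∫ z, (∑ i : Fin N, (Literature.MathematicalPhysics.KineticTheory.HeatConduction.pinnedChain ω₂ lam β γ).bondCurrent N i z) *
              (∫ y, (∑ i : Fin N, (Literature.MathematicalPhysics.KineticTheory.HeatConduction.pinnedChain ω₂ lam β γ).bondCurrent N i y) ∂((Literature.MathematicalPhysics.KineticTheory.HeatConduction.pinnedChain ω₂ lam β γ).transitionKernel N T T t.toNNReal z))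
              ∂((Literature.MathematicalPhysics.KineticTheory.HeatConduction.pinnedChain ω₂ lam β γ).gibbsMeasure N T));
      ∃ C ν₀ : ℝ, 0 ≤ C ∧ 0 < ν₀ ∧ ∀ ν : ℝ, 0 < ν → ν ≤ ν₀ → ∀ N M : ℕ, 2 ≤ N → 2 ≤ M → F N ν + F M ν -
        C ≤ F (N + M) ν)
    (hM : 
      ∀ ω₂ lam β γ : ℝ, 0 < ω₂ → 0 < lam → 0 < β → 0 < γ → ∀ T : ℝ, 0 < T → ∀ (μT :
        MeasureTheory.Measure Literature.MathematicalPhysics.KineticTheory.HeatConduction.ChainConfig)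
        (D : Literature.MathematicalPhysics.KineticTheory.HeatConduction.InfiniteChainDynamics
        (Literature.MathematicalPhysics.KineticTheory.HeatConduction.pinnedChain ω₂ lam β γ)) (κ : ℝ),
        (Literature.MathematicalPhysics.KineticTheory.HeatConduction.pinnedChain ω₂ lam β
        γ).IsChainGibbsMeasure T μT →
        Literature.MathematicalPhysics.KineticTheory.HeatConduction.IsShiftInvariant μT →
        (Literature.MathematicalPhysics.KineticTheory.HeatConduction.pinnedChain ω₂ lam β
        γ).HasSuperstabilityEstimate μT → D.PreservesMeasure μT → (∀ t : ℝ,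
        D.HasAbsConvergentCorrelation μT t) → 0 < κ → Filter.Tendsto (fun ν : ℝ => (T ^ 2)⁻¹ *
        MeasureTheory.integral (MeasureTheory.volume.restrict (Set.Ioi (0:ℝ))) (fun t : ℝ => Real.exp
        (-(ν * t)) * D.currentCorrelation μT t)) (nhdsWithin (0:ℝ) (Set.Ioi 0)) (nhds κ) →
      let F : ℕ → ℝ → ℝ := fun N ν =>
        MeasureTheory.integral (MeasureTheory.volume.restrict (Set.Ioi (0:ℝ))) (fun t : ℝ =>
          Real.exp (-(ν * t)) *
            ∫ z, (∑ i : Fin N, (Literature.MathematicalPhysics.KineticTheory.HeatConduction.pinnedChain ω₂ lam β γ).bondCurrent N i z) *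
              (∫ y, (∑ i : Fin N, (Literature.MathematicalPhysics.KineticTheory.HeatConduction.pinnedChain ω₂ lam β γ).bondCurrent N i y) ∂((Literature.MathematicalPhysics.KineticTheory.HeatConduction.pinnedChain ω₂ lam β γ).transitionKernel N T T t.toNNReal z))
              ∂((Literature.MathematicalPhysics.KineticTheory.HeatConduction.pinnedChain ω₂ lam β γ).gibbsMeasure N T));
      ∃ ν₀ : ℝ, 0 < ν₀ ∧ ∀ ν : ℝ, 0 < ν → ν ≤ ν₀ → Filter.Tendsto (fun N : ℕ => F N ν / (N : ℝ))
        Filter.atTop (nhds (MeasureTheory.integral (MeasureTheory.volume.restrict (Set.Ioi (0:ℝ))) (fun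
        t : ℝ => Real.exp (-(ν * t)) * D.currentCorrelation μT t))))
    (hR : 
      ∀ ω₂ lam β γ : ℝ, 0 < ω₂ → 0 < lam → 0 < β → 0 < γ → ∀ T : ℝ, 0 < T → (∃ (μT :
        MeasureTheory.Measure Literature.MathematicalPhysics.KineticTheory.HeatConduction.ChainConfig)
        (D : Literature.MathematicalPhysics.KineticTheory.HeatConduction.InfiniteChainDynamics
        (Literature.MathematicalPhysics.KineticTheory.HeatConduction.pinnedChain ω₂ lam β γ)) (κ : ℝ),
        (Literature.MathematicalPhysics.KineticTheory.HeatConduction.pinnedChain ω₂ lam β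
        γ).IsChainGibbsMeasure T μT ∧ D.PreservesMeasure μT ∧ (∀ t : ℝ, D.HasAbsConvergentCorrelation μT
        t) ∧ 0 < κ ∧ Filter.Tendsto (fun ν : ℝ => (T ^ 2)⁻¹ * MeasureTheory.integral
        (MeasureTheory.volume.restrict (Set.Ioi (0:ℝ))) (fun t : ℝ => Real.exp (-(ν * t)) *
        D.currentCorrelation μT t)) (nhdsWithin (0:ℝ) (Set.Ioi 0)) (nhds κ)) →
      let F : ℕ → ℝ → ℝ := fun N ν =>
        MeasureTheory.integral (MeasureTheory.volume.restrict (Set.Ioi (0:ℝ))) (fun t : ℝ =>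
          Real.exp (-(ν * t)) *
            ∫ z, (∑ i : Fin N, (Literature.MathematicalPhysics.KineticTheory.HeatConduction.pinnedChain ω₂ lam β γ).bondCurrent N i z) *
              (∫ y, (∑ i : Fin N, (Literature.MathematicalPhysics.KineticTheory.HeatConduction.pinnedChain ω₂ lam β γ).bondCurrent N i y) ∂((Literature.MathematicalPhysics.KineticTheory.HeatConduction.pinnedChain ω₂ lam β γ).transitionKernel N T T t.toNNReal z))
              ∂((Literature.MathematicalPhysics.KineticTheory.HeatConduction.pinnedChain ω₂ lam β γ).gibbsMeasure N T));
      ∀ ε : ℝ, 0 < ε → ∃ ν₀ : ℝ, 0 < ν₀ ∧ ∀ ν : ℝ, 0 < ν → ν ≤ ν₀ → ∃ N₀ : ℕ, ∀ N : ℕ, N₀ ≤ N →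
        Filter.Eventually (fun ν' : ℝ => F N ν - F N ν' ≤ ε * (N : ℝ)) (nhdsWithin (0:ℝ) (Set.Ioi 0)))
    (hW : 
      ∀ ω₂ lam β γ : ℝ, 0 < ω₂ → 0 < lam → 0 < β → 0 < γ → ∀ T : ℝ, 0 < T → (∃ (μT :
        MeasureTheory.Measure Literature.MathematicalPhysics.KineticTheory.HeatConduction.ChainConfig)
        (D' : Literature.MathematicalPhysics.KineticTheory.HeatConduction.InfiniteChainDynamics
        (Literature.MathematicalPhysics.KineticTheory.HeatConduction.pinnedChain ω₂ lam β γ)) (κ : ℝ),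
        (Literature.MathematicalPhysics.KineticTheory.HeatConduction.pinnedChain ω₂ lam β
        γ).IsChainGibbsMeasure T μT ∧ D'.PreservesMeasure μT ∧ (∀ t : ℝ, D'.HasAbsConvergentCorrelation
        μT t) ∧ 0 < κ ∧ Filter.Tendsto (fun ν : ℝ => (T ^ 2)⁻¹ * MeasureTheory.integral
        (MeasureTheory.volume.restrict (Set.Ioi (0:ℝ))) (fun t : ℝ => Real.exp (-(ν * t)) *
        D'.currentCorrelation μT t)) (nhdsWithin (0:ℝ) (Set.Ioi 0)) (nhds κ)) → ∃ (μT :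
        MeasureTheory.Measure Literature.MathematicalPhysics.KineticTheory.HeatConduction.ChainConfig)
        (D' : Literature.MathematicalPhysics.KineticTheory.HeatConduction.InfiniteChainDynamics
        (Literature.MathematicalPhysics.KineticTheory.HeatConduction.pinnedChain ω₂ lam β γ)) (κ : ℝ),
        (Literature.MathematicalPhysics.KineticTheory.HeatConduction.pinnedChain ω₂ lam β
        γ).IsChainGibbsMeasure T μT ∧
        Literature.MathematicalPhysics.KineticTheory.HeatConduction.IsShiftInvariant μT ∧
        (Literature.MathematicalPhysics.KineticTheory.HeatConduction.pinnedChain ω₂ lam β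
        γ).HasSuperstabilityEstimate μT ∧ D'.PreservesMeasure μT ∧ (∀ t : ℝ,
        D'.HasAbsConvergentCorrelation μT t) ∧ 0 < κ ∧ Filter.Tendsto (fun ν : ℝ => (T ^ 2)⁻¹ *
        MeasureTheory.integral (MeasureTheory.volume.restrict (Set.Ioi (0:ℝ))) (fun t : ℝ => Real.exp
        (-(ν * t)) * D'.currentCorrelation μT t)) (nhdsWithin (0:ℝ) (Set.Ioi 0)) (nhds κ)
) :
    ∀ ω₂ lam β γ : ℝ, 0 < ω₂ → 0 < lam → 0 < β → 0 < γ → (∀ (N : ℕ) (T_L T_R : ℝ), 0 < T_L → 0 < T_R → ∀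
      μ ν : MeasureTheory.Measure
      (Literature.MathematicalPhysics.KineticTheory.HeatConduction.PhaseSpace N),
      (Literature.MathematicalPhysics.KineticTheory.HeatConduction.pinnedChain ω₂ lam β γ).IsSteadyState
      N T_L T_R μ → (Literature.MathematicalPhysics.KineticTheory.HeatConduction.pinnedChain ω₂ lam β
      γ).IsSteadyState N T_L T_R ν → μ = ν) → ∀ T : ℝ, 0 < T → (∃ (μT : MeasureTheory.Measure
      Literature.MathematicalPhysics.KineticTheory.HeatConduction.ChainConfig) (D :
      Literature.MathematicalPhysics.KineticTheory.HeatConduction.InfiniteChainDynamics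
      (Literature.MathematicalPhysics.KineticTheory.HeatConduction.pinnedChain ω₂ lam β γ)) (κ : ℝ),
      (Literature.MathematicalPhysics.KineticTheory.HeatConduction.pinnedChain ω₂ lam β
      γ).IsChainGibbsMeasure T μT ∧ D.PreservesMeasure μT ∧ (∀ t : ℝ, D.HasAbsConvergentCorrelation μT
      t) ∧ 0 < κ ∧ Filter.Tendsto (fun ν : ℝ => (T ^ 2)⁻¹ * MeasureTheory.integral
      (MeasureTheory.volume.restrict (Set.Ioi (0:ℝ))) (fun t : ℝ => Real.exp (-(ν * t)) *
      D.currentCorrelation μT t)) (nhdsWithin (0:ℝ) (Set.Ioi 0)) (nhds κ)) → ∃ (μT :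
      MeasureTheory.Measure Literature.MathematicalPhysics.KineticTheory.HeatConduction.ChainConfig) (D
      : Literature.MathematicalPhysics.KineticTheory.HeatConduction.InfiniteChainDynamics
      (Literature.MathematicalPhysics.KineticTheory.HeatConduction.pinnedChain ω₂ lam β γ)) (κ : ℝ),
      ((Literature.MathematicalPhysics.KineticTheory.HeatConduction.pinnedChain ω₂ lam β
      γ).IsChainGibbsMeasure T μT ∧ D.PreservesMeasure μT ∧ (∀ t : ℝ, D.HasAbsConvergentCorrelation μT
      t) ∧ 0 < κ ∧ Filter.Tendsto (fun ν : ℝ => (T ^ 2)⁻¹ * MeasureTheory.integral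
      (MeasureTheory.volume.restrict (Set.Ioi (0:ℝ))) (fun t : ℝ => Real.exp (-(ν * t)) *
      D.currentCorrelation μT t)) (nhdsWithin (0:ℝ) (Set.Ioi 0)) (nhds κ)) ∧ ∀ μ : (N : ℕ) → ℝ → ℝ →
      MeasureTheory.Measure (Literature.MathematicalPhysics.KineticTheory.HeatConduction.PhaseSpace N),
      (∀ (N : ℕ) (T_L T_R : ℝ), 0 < T_L → 0 < T_R →
      (Literature.MathematicalPhysics.KineticTheory.HeatConduction.pinnedChain ω₂ lam β γ).IsSteadyState
      N T_L T_R (μ N T_L T_R)) → ∀ Dn : ℕ → ℝ, (∀ N : ℕ, Filter.Tendsto (fun δ : ℝ =>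
      (Literature.MathematicalPhysics.KineticTheory.HeatConduction.pinnedChain ω₂ lam β γ).totalCurrent
      (μ N (T + δ / 2) (T - δ / 2)) / δ) (nhdsWithin 0 {(0 : ℝ)}ᶜ) (nhds (Dn N))) → Filter.Tendsto Dn
      Filter.atTop (nhds κ)
 := by
  intro ω₂ lam β γ hω hl hβ hγ hU T hT hex
  -- S5: regularise the witness, and output the regular one
  obtain ⟨μT, D, κ, hG, hS, hss, hP, hAC, hκ, hAbel⟩ := hW ω₂ lam β γ hω hl hβ hγ T hT hex
  refine ⟨μT, D, κ, ⟨hG, hP, hAC, hκ, hAbel⟩, ?_⟩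
  intro μ hμ Dn hD
  -- S1: integrability of `c_N` and the DC identity, at every `N`
  have hK' : ∀ N : ℕ, IntegrableOn (cN ω₂ lam β γ T N) (Ioi 0) ∧
      ((N : ℝ) - 1) * T ^ 2 * Dn N = ∫ t in Ioi (0 : ℝ), cN ω₂ lam β γ T N t :=
    fun N => hK ω₂ lam β γ hω hl hβ hγ hU μ hμ T hT N (Dn N) (hD N)
  have hDC : ∀ N : ℕ, Tendsto (FN ω₂ lam β γ T N) (𝓝[>] 0) (𝓝 (((N : ℝ) - 1) * T ^ 2 * Dn N)) := by
    intro N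
    rw [(hK' N).2]
    exact RealAnalysis.tendsto_laplace_zero (hK' N).1
  -- S2: the sign law
  obtain ⟨C, ν₁, -, hν₁, hqs⟩ := hQS ω₂ lam β γ hω hl hβ hγ T hT
  -- S3: fixed-frequency matching for the regular witness
  obtain ⟨ν₂, hν₂, hmatch⟩ := hM ω₂ lam β γ hω hl hβ hγ T hT μT D κ hG hS hss hP hAC hκ hAbel
  -- the witness: `Â(ν) → T²κ`
  have hT2 : (T ^ 2) ≠ 0 := by positivity
  have hA : Tendsto (fun ν : ℝ => ∫ t in Ioi (0 : ℝ), Real.exp (-(ν * t)) * D.currentCorrelation μT t)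
      (𝓝[>] 0) (𝓝 (T ^ 2 * κ)) := by
    have h := hAbel.const_mul (T ^ 2)
    refine h.congr' (Eventually.of_forall fun ν => ?_)
    simp only
    rw [← mul_assoc, mul_inv_cancel₀ hT2, one_mul]
  -- upper half: Fekete at every Laplace frequency
  have hup : ∀ N : ℕ, 2 ≤ N → ((N : ℝ) - 1) * T ^ 2 * Dn N ≤ N * (T ^ 2 * κ) + C :=
    RealAnalysis.fekete_abel_upper (FN ω₂ lam β γ T) (fun N => ((N : ℝ) - 1) * T ^ 2 * Dn N)
      (fun ν => ∫ t in Ioi (0 : ℝ), Real.exp (-(ν * t)) * D.currentCorrelation μT t) C (T ^ 2 * κ)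
      (min ν₁ ν₂) (lt_min hν₁ hν₂)
      (fun ν hν N M hN hM => hqs ν hν.1 (le_trans hν.2 (min_le_left _ _)) N M hN hM)
      (fun ν hν => hmatch ν hν.1 (le_trans hν.2 (min_le_right _ _)))
      hA (fun N _ => hDC N)
  -- lower half: no extensive DC notch
  have hlow : ∀ ε : ℝ, 0 < ε → ∀ᶠ N : ℕ in atTop, (T ^ 2 * κ - ε) * N ≤ ((N : ℝ) - 1) * T ^ 2 * Dn N :=
    RealAnalysis.abel_lower (FN ω₂ lam β γ T) (fun N => ((N : ℝ) - 1) * T ^ 2 * Dn N)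
      (fun ν => ∫ t in Ioi (0 : ℝ), Real.exp (-(ν * t)) * D.currentCorrelation μT t) (T ^ 2 * κ) ν₂ hν₂
      (fun ν hν => hmatch ν hν.1 hν.2) hA hDC
      (hR ω₂ lam β γ hω hl hβ hγ T hT hex)
  -- squeeze, then `N/(N-1) → 1`
  exact RealAnalysis.tendsto_response_of_tendsto_div Dn T κ hT
    (RealAnalysis.tendsto_div_of_two_sided _ _ C hup hlow)

/-- **The skeleton theorem: the five stubs prove the crux BY NAME.** (This term carries the stubs'
`sorry`s through `reduction` and is NOT a proof claim; it is the unique theorem of this file concluding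
`EmbeddedDrudeMourre.AbelThermodynamicLimit`, which is what `#h21_check_skeleton` audits.) -/
theorem AbelThermodynamicLimit_of :
    Summit.AtomisticToContinuum.FouriersLaw.Theses.EmbeddedDrudeMourre.AbelThermodynamicLimit :=
  reduction stub_openKuboAbel stub_quasiSuperadditivity stub_fixedFrequencyMatching
    stub_noExtensiveDCNotch stub_witnessRegularisation

/-! ## By-product without the residual: the no-overshoot law (upper half, `HasBoundedResponse`-sharp) -/

/-- **No-overshoot law** (S1 + S2 + S3 + S5, NO (R⁻)): under `Uniq`, at every `T > 0` carrying an Abelian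
Green–Kubo witness there is a regular witness `(μT, D, κ)` and a constant `C ≥ 0` (the junction
allowance of QS) such that for EVERY steady family, EVERY response sequence and EVERY `N ≥ 2`:
`(N−1)·T²·Dn N ≤ N·T²κ + C`, i.e. `D_N ≤ κ + (κ + C/T²)/(N−1)` — `limsup_N D_N ≤ κ_A` and
`HasBoundedResponse` at `T` follow. This is the triage's falsifiable fingerprint (r1-1 (a), r1-3 (ii)):
an overshoot of `D_N` above `κ` relaxing slower than `1/N` in the diffusive-regime MD kills QS. -/
theorem noOvershoot_of
    (hK : 
      ∀ ω₂ lam β γ : ℝ, 0 < ω₂ → 0 < lam → 0 < β → 0 < γ → (∀ (N : ℕ) (T_L T_R : ℝ), 0 < T_L → 0 < T_R →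
        ∀ μ ν : MeasureTheory.Measure
        (Literature.MathematicalPhysics.KineticTheory.HeatConduction.PhaseSpace N),
        (Literature.MathematicalPhysics.KineticTheory.HeatConduction.pinnedChain ω₂ lam β
        γ).IsSteadyState N T_L T_R μ →
        (Literature.MathematicalPhysics.KineticTheory.HeatConduction.pinnedChain ω₂ lam β
        γ).IsSteadyState N T_L T_R ν → μ = ν) → ∀ μ : (N : ℕ) → ℝ → ℝ → MeasureTheory.Measure
        (Literature.MathematicalPhysics.KineticTheory.HeatConduction.PhaseSpace N), (∀ (N : ℕ) (T_L T_R
        : ℝ), 0 < T_L → 0 < T_R →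
        (Literature.MathematicalPhysics.KineticTheory.HeatConduction.pinnedChain ω₂ lam β
        γ).IsSteadyState N T_L T_R (μ N T_L T_R)) → ∀ T : ℝ, 0 < T → ∀ N : ℕ, ∀ D : ℝ, Filter.Tendsto
        (fun δ : ℝ => (Literature.MathematicalPhysics.KineticTheory.HeatConduction.pinnedChain ω₂ lam β
        γ).totalCurrent (μ N (T + δ / 2) (T - δ / 2)) / δ) (nhdsWithin 0 {(0 : ℝ)}ᶜ) (nhds D) →
      let J : Literature.MathematicalPhysics.KineticTheory.HeatConduction.PhaseSpace N → ℝ := fun z => ∑ i : Fin N, (Literature.MathematicalPhysics.KineticTheory.HeatConduction.pinnedChain ω₂ lam β γ).bondCurrent N i z;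
      MeasureTheory.IntegrableOn (fun t : ℝ => ∫ z, J z * (∫ y, J y
        ∂((Literature.MathematicalPhysics.KineticTheory.HeatConduction.pinnedChain ω₂ lam β
        γ).transitionKernel N T T t.toNNReal z))
        ∂((Literature.MathematicalPhysics.KineticTheory.HeatConduction.pinnedChain ω₂ lam β
        γ).gibbsMeasure N T)) (Set.Ioi 0) ∧ ((N:ℝ) - 1) * T ^ 2 * D = ∫ t in Set.Ioi (0:ℝ), ∫ z, J z *
        (∫ y, J y ∂((Literature.MathematicalPhysics.KineticTheory.HeatConduction.pinnedChain ω₂ lam β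
        γ).transitionKernel N T T t.toNNReal z))
        ∂((Literature.MathematicalPhysics.KineticTheory.HeatConduction.pinnedChain ω₂ lam β
        γ).gibbsMeasure N T))
    (hQS : 
      ∀ ω₂ lam β γ : ℝ, 0 < ω₂ → 0 < lam → 0 < β → 0 < γ → ∀ T : ℝ, 0 < T →
      let F : ℕ → ℝ → ℝ := fun N ν =>
        MeasureTheory.integral (MeasureTheory.volume.restrict (Set.Ioi (0:ℝ))) (fun t : ℝ =>
          Real.exp (-(ν * t)) *
            ∫ z, (∑ i : Fin N, (Literature.MathematicalPhysics.KineticTheory.HeatConduction.pinnedChain ω₂ lam β γ).bondCurrent N i z) *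
              (∫ y, (∑ i : Fin N, (Literature.MathematicalPhysics.KineticTheory.HeatConduction.pinnedChain ω₂ lam β γ).bondCurrent N i y) ∂((Literature.MathematicalPhysics.KineticTheory.HeatConduction.pinnedChain ω₂ lam β γ).transitionKernel N T T t.toNNReal z))
              ∂((Literature.MathematicalPhysics.KineticTheory.HeatConduction.pinnedChain ω₂ lam β γ).gibbsMeasure N T));
      ∃ C ν₀ : ℝ, 0 ≤ C ∧ 0 < ν₀ ∧ ∀ ν : ℝ, 0 < ν → ν ≤ ν₀ → ∀ N M : ℕ, 2 ≤ N → 2 ≤ M → F N ν + F M ν -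
        C ≤ F (N + M) ν)
    (hM : 
      ∀ ω₂ lam β γ : ℝ, 0 < ω₂ → 0 < lam → 0 < β → 0 < γ → ∀ T : ℝ, 0 < T → ∀ (μT :
        MeasureTheory.Measure Literature.MathematicalPhysics.KineticTheory.HeatConduction.ChainConfig)
        (D : Literature.MathematicalPhysics.KineticTheory.HeatConduction.InfiniteChainDynamics
        (Literature.MathematicalPhysics.KineticTheory.HeatConduction.pinnedChain ω₂ lam β γ)) (κ : ℝ),
        (Literature.MathematicalPhysics.KineticTheory.HeatConduction.pinnedChain ω₂ lam β
        γ).IsChainGibbsMeasure T μT →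
        Literature.MathematicalPhysics.KineticTheory.HeatConduction.IsShiftInvariant μT →
        (Literature.MathematicalPhysics.KineticTheory.HeatConduction.pinnedChain ω₂ lam β
        γ).HasSuperstabilityEstimate μT → D.PreservesMeasure μT → (∀ t : ℝ,
        D.HasAbsConvergentCorrelation μT t) → 0 < κ → Filter.Tendsto (fun ν : ℝ => (T ^ 2)⁻¹ *
        MeasureTheory.integral (MeasureTheory.volume.restrict (Set.Ioi (0:ℝ))) (fun t : ℝ => Real.exp
        (-(ν * t)) * D.currentCorrelation μT t)) (nhdsWithin (0:ℝ) (Set.Ioi 0)) (nhds κ) →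
      let F : ℕ → ℝ → ℝ := fun N ν =>
        MeasureTheory.integral (MeasureTheory.volume.restrict (Set.Ioi (0:ℝ))) (fun t : ℝ =>
          Real.exp (-(ν * t)) *
            ∫ z, (∑ i : Fin N, (Literature.MathematicalPhysics.KineticTheory.HeatConduction.pinnedChain ω₂ lam β γ).bondCurrent N i z) *
              (∫ y, (∑ i : Fin N, (Literature.MathematicalPhysics.KineticTheory.HeatConduction.pinnedChain ω₂ lam β γ).bondCurrent N i y) ∂((Literature.MathematicalPhysics.KineticTheory.HeatConduction.pinnedChain ω₂ lam β γ).transitionKernel N T T t.toNNReal z))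
              ∂((Literature.MathematicalPhysics.KineticTheory.HeatConduction.pinnedChain ω₂ lam β γ).gibbsMeasure N T));
      ∃ ν₀ : ℝ, 0 < ν₀ ∧ ∀ ν : ℝ, 0 < ν → ν ≤ ν₀ → Filter.Tendsto (fun N : ℕ => F N ν / (N : ℝ))
        Filter.atTop (nhds (MeasureTheory.integral (MeasureTheory.volume.restrict (Set.Ioi (0:ℝ))) (fun
        t : ℝ => Real.exp (-(ν * t)) * D.currentCorrelation μT t))))
    (hW : 
      ∀ ω₂ lam β γ : ℝ, 0 < ω₂ → 0 < lam → 0 < β → 0 < γ → ∀ T : ℝ, 0 < T → (∃ (μT :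
        MeasureTheory.Measure Literature.MathematicalPhysics.KineticTheory.HeatConduction.ChainConfig)
        (D' : Literature.MathematicalPhysics.KineticTheory.HeatConduction.InfiniteChainDynamics
        (Literature.MathematicalPhysics.KineticTheory.HeatConduction.pinnedChain ω₂ lam β γ)) (κ : ℝ),
        (Literature.MathematicalPhysics.KineticTheory.HeatConduction.pinnedChain ω₂ lam β
        γ).IsChainGibbsMeasure T μT ∧ D'.PreservesMeasure μT ∧ (∀ t : ℝ, D'.HasAbsConvergentCorrelation
        μT t) ∧ 0 < κ ∧ Filter.Tendsto (fun ν : ℝ => (T ^ 2)⁻¹ * MeasureTheory.integral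
        (MeasureTheory.volume.restrict (Set.Ioi (0:ℝ))) (fun t : ℝ => Real.exp (-(ν * t)) *
        D'.currentCorrelation μT t)) (nhdsWithin (0:ℝ) (Set.Ioi 0)) (nhds κ)) → ∃ (μT :
        MeasureTheory.Measure Literature.MathematicalPhysics.KineticTheory.HeatConduction.ChainConfig)
        (D' : Literature.MathematicalPhysics.KineticTheory.HeatConduction.InfiniteChainDynamics
        (Literature.MathematicalPhysics.KineticTheory.HeatConduction.pinnedChain ω₂ lam β γ)) (κ : ℝ),
        (Literature.MathematicalPhysics.KineticTheory.HeatConduction.pinnedChain ω₂ lam β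
        γ).IsChainGibbsMeasure T μT ∧
        Literature.MathematicalPhysics.KineticTheory.HeatConduction.IsShiftInvariant μT ∧
        (Literature.MathematicalPhysics.KineticTheory.HeatConduction.pinnedChain ω₂ lam β
        γ).HasSuperstabilityEstimate μT ∧ D'.PreservesMeasure μT ∧ (∀ t : ℝ,
        D'.HasAbsConvergentCorrelation μT t) ∧ 0 < κ ∧ Filter.Tendsto (fun ν : ℝ => (T ^ 2)⁻¹ *
        MeasureTheory.integral (MeasureTheory.volume.restrict (Set.Ioi (0:ℝ))) (fun t : ℝ => Real.exp
        (-(ν * t)) * D'.currentCorrelation μT t)) (nhdsWithin (0:ℝ) (Set.Ioi 0)) (nhds κ)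
) :
    ∀ ω₂ lam β γ : ℝ, 0 < ω₂ → 0 < lam → 0 < β → 0 < γ → (∀ (N : ℕ) (T_L T_R : ℝ), 0 < T_L → 0 < T_R → ∀
      μ ν : MeasureTheory.Measure
      (Literature.MathematicalPhysics.KineticTheory.HeatConduction.PhaseSpace N),
      (Literature.MathematicalPhysics.KineticTheory.HeatConduction.pinnedChain ω₂ lam β γ).IsSteadyState
      N T_L T_R μ → (Literature.MathematicalPhysics.KineticTheory.HeatConduction.pinnedChain ω₂ lam β
      γ).IsSteadyState N T_L T_R ν → μ = ν) → ∀ T : ℝ, 0 < T → (∃ (μT : MeasureTheory.Measure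
      Literature.MathematicalPhysics.KineticTheory.HeatConduction.ChainConfig) (D :
      Literature.MathematicalPhysics.KineticTheory.HeatConduction.InfiniteChainDynamics
      (Literature.MathematicalPhysics.KineticTheory.HeatConduction.pinnedChain ω₂ lam β γ)) (κ : ℝ),
      (Literature.MathematicalPhysics.KineticTheory.HeatConduction.pinnedChain ω₂ lam β
      γ).IsChainGibbsMeasure T μT ∧ D.PreservesMeasure μT ∧ (∀ t : ℝ, D.HasAbsConvergentCorrelation μT
      t) ∧ 0 < κ ∧ Filter.Tendsto (fun ν : ℝ => (T ^ 2)⁻¹ * MeasureTheory.integral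
      (MeasureTheory.volume.restrict (Set.Ioi (0:ℝ))) (fun t : ℝ => Real.exp (-(ν * t)) *
      D.currentCorrelation μT t)) (nhdsWithin (0:ℝ) (Set.Ioi 0)) (nhds κ)) → ∃ (μT :
      MeasureTheory.Measure Literature.MathematicalPhysics.KineticTheory.HeatConduction.ChainConfig) (D
      : Literature.MathematicalPhysics.KineticTheory.HeatConduction.InfiniteChainDynamics
      (Literature.MathematicalPhysics.KineticTheory.HeatConduction.pinnedChain ω₂ lam β γ)) (κ : ℝ),
      ((Literature.MathematicalPhysics.KineticTheory.HeatConduction.pinnedChain ω₂ lam β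
      γ).IsChainGibbsMeasure T μT ∧
      Literature.MathematicalPhysics.KineticTheory.HeatConduction.IsShiftInvariant μT ∧
      (Literature.MathematicalPhysics.KineticTheory.HeatConduction.pinnedChain ω₂ lam β
      γ).HasSuperstabilityEstimate μT ∧ D.PreservesMeasure μT ∧ (∀ t : ℝ, D.HasAbsConvergentCorrelation
      μT t) ∧ 0 < κ ∧ Filter.Tendsto (fun ν : ℝ => (T ^ 2)⁻¹ * MeasureTheory.integral
      (MeasureTheory.volume.restrict (Set.Ioi (0:ℝ))) (fun t : ℝ => Real.exp (-(ν * t)) *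
      D.currentCorrelation μT t)) (nhdsWithin (0:ℝ) (Set.Ioi 0)) (nhds κ)) ∧ ∃ C : ℝ, 0 ≤ C ∧ ∀ μ : (N :
      ℕ) → ℝ → ℝ → MeasureTheory.Measure
      (Literature.MathematicalPhysics.KineticTheory.HeatConduction.PhaseSpace N), (∀ (N : ℕ) (T_L T_R :
      ℝ), 0 < T_L → 0 < T_R → (Literature.MathematicalPhysics.KineticTheory.HeatConduction.pinnedChain
      ω₂ lam β γ).IsSteadyState N T_L T_R (μ N T_L T_R)) → ∀ Dn : ℕ → ℝ, (∀ N : ℕ, Filter.Tendsto (fun δ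
      : ℝ => (Literature.MathematicalPhysics.KineticTheory.HeatConduction.pinnedChain ω₂ lam β
      γ).totalCurrent (μ N (T + δ / 2) (T - δ / 2)) / δ) (nhdsWithin 0 {(0 : ℝ)}ᶜ) (nhds (Dn N))) → ∀ N
      : ℕ, 2 ≤ N → ((N : ℝ) - 1) * T ^ 2 * Dn N ≤ N * (T ^ 2 * κ) + C
 := by
  intro ω₂ lam β γ hω hl hβ hγ hU T hT hex
  obtain ⟨μT, D, κ, hG, hS, hss, hP, hAC, hκ, hAbel⟩ := hW ω₂ lam β γ hω hl hβ hγ T hT hex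
  obtain ⟨C, ν₁, hC0, hν₁, hqs⟩ := hQS ω₂ lam β γ hω hl hβ hγ T hT
  obtain ⟨ν₂, hν₂, hmatch⟩ := hM ω₂ lam β γ hω hl hβ hγ T hT μT D κ hG hS hss hP hAC hκ hAbel
  refine ⟨μT, D, κ, ⟨hG, hS, hss, hP, hAC, hκ, hAbel⟩, C, hC0, ?_⟩
  intro μ hμ Dn hD
  have hK' : ∀ N : ℕ, IntegrableOn (cN ω₂ lam β γ T N) (Ioi 0) ∧
      ((N : ℝ) - 1) * T ^ 2 * Dn N = ∫ t in Ioi (0 : ℝ), cN ω₂ lam β γ T N t :=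
    fun N => hK ω₂ lam β γ hω hl hβ hγ hU μ hμ T hT N (Dn N) (hD N)
  have hDC : ∀ N : ℕ, Tendsto (FN ω₂ lam β γ T N) (𝓝[>] 0) (𝓝 (((N : ℝ) - 1) * T ^ 2 * Dn N)) := by
    intro N
    rw [(hK' N).2]
    exact RealAnalysis.tendsto_laplace_zero (hK' N).1
  have hT2 : (T ^ 2) ≠ 0 := by positivity
  have hA : Tendsto (fun ν : ℝ => ∫ t in Ioi (0 : ℝ), Real.exp (-(ν * t)) * D.currentCorrelation μT t)
      (𝓝[>] 0) (𝓝 (T ^ 2 * κ)) := by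
    have h := hAbel.const_mul (T ^ 2)
    refine h.congr' (Eventually.of_forall fun ν => ?_)
    simp only
    rw [← mul_assoc, mul_inv_cancel₀ hT2, one_mul]
  exact RealAnalysis.fekete_abel_upper (FN ω₂ lam β γ T) (fun N => ((N : ℝ) - 1) * T ^ 2 * Dn N)
    (fun ν => ∫ t in Ioi (0 : ℝ), Real.exp (-(ν * t)) * D.currentCorrelation μT t) C (T ^ 2 * κ)
    (min ν₁ ν₂) (lt_min hν₁ hν₂)
    (fun ν hν N M hN hM => hqs ν hν.1 (le_trans hν.2 (min_le_left _ _)) N M hN hM)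
    (fun ν hν => hmatch ν hν.1 (le_trans hν.2 (min_le_right _ _)))
    hA (fun N _ => hDC N)

/-! ## The residual is crux-equivalent given the infrastructure (S4 is not a costume, and not stronger) -/

/-- **S4 follows from the crux's conclusion** (given S1, S3): for a regular witness `(μT, D, κ)` at `T`
for which the crux's conclusion holds (`Dn → κ` for every steady family / response sequence) and ONE
steady family with a response sequence exists (item `FiniteResponseOfUnique`), the one-sided notch
bound of `stub_noExtensiveDCNotch` holds at `T` (`RealAnalysis.notch_of_limit`). Together with
`reduction` this shows: modulo S1 + S3 + S5 (+ 0717), S2 ∧ S4 ⇒ crux ⇒ S4. -/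
theorem noExtensiveDCNotch_of_crux
    (hK : 
      ∀ ω₂ lam β γ : ℝ, 0 < ω₂ → 0 < lam → 0 < β → 0 < γ → (∀ (N : ℕ) (T_L T_R : ℝ), 0 < T_L → 0 < T_R →
        ∀ μ ν : MeasureTheory.Measure
        (Literature.MathematicalPhysics.KineticTheory.HeatConduction.PhaseSpace N),
        (Literature.MathematicalPhysics.KineticTheory.HeatConduction.pinnedChain ω₂ lam β
        γ).IsSteadyState N T_L T_R μ →
        (Literature.MathematicalPhysics.KineticTheory.HeatConduction.pinnedChain ω₂ lam β
        γ).IsSteadyState N T_L T_R ν → μ = ν) → ∀ μ : (N : ℕ) → ℝ → ℝ → MeasureTheory.Measure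
        (Literature.MathematicalPhysics.KineticTheory.HeatConduction.PhaseSpace N), (∀ (N : ℕ) (T_L T_R
        : ℝ), 0 < T_L → 0 < T_R →
        (Literature.MathematicalPhysics.KineticTheory.HeatConduction.pinnedChain ω₂ lam β
        γ).IsSteadyState N T_L T_R (μ N T_L T_R)) → ∀ T : ℝ, 0 < T → ∀ N : ℕ, ∀ D : ℝ, Filter.Tendsto
        (fun δ : ℝ => (Literature.MathematicalPhysics.KineticTheory.HeatConduction.pinnedChain ω₂ lam β
        γ).totalCurrent (μ N (T + δ / 2) (T - δ / 2)) / δ) (nhdsWithin 0 {(0 : ℝ)}ᶜ) (nhds D) →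
      let J : Literature.MathematicalPhysics.KineticTheory.HeatConduction.PhaseSpace N → ℝ := fun z => ∑ i : Fin N, (Literature.MathematicalPhysics.KineticTheory.HeatConduction.pinnedChain ω₂ lam β γ).bondCurrent N i z;
      MeasureTheory.IntegrableOn (fun t : ℝ => ∫ z, J z * (∫ y, J y
        ∂((Literature.MathematicalPhysics.KineticTheory.HeatConduction.pinnedChain ω₂ lam β
        γ).transitionKernel N T T t.toNNReal z))
        ∂((Literature.MathematicalPhysics.KineticTheory.HeatConduction.pinnedChain ω₂ lam β
        γ).gibbsMeasure N T)) (Set.Ioi 0) ∧ ((N:ℝ) - 1) * T ^ 2 * D = ∫ t in Set.Ioi (0:ℝ), ∫ z, J z *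
        (∫ y, J y ∂((Literature.MathematicalPhysics.KineticTheory.HeatConduction.pinnedChain ω₂ lam β
        γ).transitionKernel N T T t.toNNReal z))
        ∂((Literature.MathematicalPhysics.KineticTheory.HeatConduction.pinnedChain ω₂ lam β
        γ).gibbsMeasure N T))
    (hM : 
      ∀ ω₂ lam β γ : ℝ, 0 < ω₂ → 0 < lam → 0 < β → 0 < γ → ∀ T : ℝ, 0 < T → ∀ (μT :
        MeasureTheory.Measure Literature.MathematicalPhysics.KineticTheory.HeatConduction.ChainConfig)
        (D : Literature.MathematicalPhysics.KineticTheory.HeatConduction.InfiniteChainDynamics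
        (Literature.MathematicalPhysics.KineticTheory.HeatConduction.pinnedChain ω₂ lam β γ)) (κ : ℝ),
        (Literature.MathematicalPhysics.KineticTheory.HeatConduction.pinnedChain ω₂ lam β
        γ).IsChainGibbsMeasure T μT →
        Literature.MathematicalPhysics.KineticTheory.HeatConduction.IsShiftInvariant μT →
        (Literature.MathematicalPhysics.KineticTheory.HeatConduction.pinnedChain ω₂ lam β
        γ).HasSuperstabilityEstimate μT → D.PreservesMeasure μT → (∀ t : ℝ,
        D.HasAbsConvergentCorrelation μT t) → 0 < κ → Filter.Tendsto (fun ν : ℝ => (T ^ 2)⁻¹ *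
        MeasureTheory.integral (MeasureTheory.volume.restrict (Set.Ioi (0:ℝ))) (fun t : ℝ => Real.exp
        (-(ν * t)) * D.currentCorrelation μT t)) (nhdsWithin (0:ℝ) (Set.Ioi 0)) (nhds κ) →
      let F : ℕ → ℝ → ℝ := fun N ν =>
        MeasureTheory.integral (MeasureTheory.volume.restrict (Set.Ioi (0:ℝ))) (fun t : ℝ =>
          Real.exp (-(ν * t)) *
            ∫ z, (∑ i : Fin N, (Literature.MathematicalPhysics.KineticTheory.HeatConduction.pinnedChain ω₂ lam β γ).bondCurrent N i z) *
              (∫ y, (∑ i : Fin N, (Literature.MathematicalPhysics.KineticTheory.HeatConduction.pinnedChain ω₂ lam β γ).bondCurrent N i y) ∂((Literature.MathematicalPhysics.KineticTheory.HeatConduction.pinnedChain ω₂ lam β γ).transitionKernel N T T t.toNNReal z))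
              ∂((Literature.MathematicalPhysics.KineticTheory.HeatConduction.pinnedChain ω₂ lam β γ).gibbsMeasure N T));
      ∃ ν₀ : ℝ, 0 < ν₀ ∧ ∀ ν : ℝ, 0 < ν → ν ≤ ν₀ → Filter.Tendsto (fun N : ℕ => F N ν / (N : ℝ))
        Filter.atTop (nhds (MeasureTheory.integral (MeasureTheory.volume.restrict (Set.Ioi (0:ℝ))) (fun
        t : ℝ => Real.exp (-(ν * t)) * D.currentCorrelation μT t)))) :
    ∀ ω₂ lam β γ : ℝ, 0 < ω₂ → 0 < lam → 0 < β → 0 < γ → (∀ (N : ℕ) (T_L T_R : ℝ), 0 < T_L → 0 < T_R → ∀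
      μ ν : MeasureTheory.Measure
      (Literature.MathematicalPhysics.KineticTheory.HeatConduction.PhaseSpace N),
      (Literature.MathematicalPhysics.KineticTheory.HeatConduction.pinnedChain ω₂ lam β γ).IsSteadyState
      N T_L T_R μ → (Literature.MathematicalPhysics.KineticTheory.HeatConduction.pinnedChain ω₂ lam β
      γ).IsSteadyState N T_L T_R ν → μ = ν) → ∀ T : ℝ, 0 < T → ∀ (μT : MeasureTheory.Measure
      Literature.MathematicalPhysics.KineticTheory.HeatConduction.ChainConfig) (D :
      Literature.MathematicalPhysics.KineticTheory.HeatConduction.InfiniteChainDynamics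
      (Literature.MathematicalPhysics.KineticTheory.HeatConduction.pinnedChain ω₂ lam β γ)) (κ : ℝ),
      (Literature.MathematicalPhysics.KineticTheory.HeatConduction.pinnedChain ω₂ lam β
      γ).IsChainGibbsMeasure T μT →
      Literature.MathematicalPhysics.KineticTheory.HeatConduction.IsShiftInvariant μT →
      (Literature.MathematicalPhysics.KineticTheory.HeatConduction.pinnedChain ω₂ lam β
      γ).HasSuperstabilityEstimate μT → D.PreservesMeasure μT → (∀ t : ℝ, D.HasAbsConvergentCorrelation
      μT t) → 0 < κ → Filter.Tendsto (fun ν : ℝ => (T ^ 2)⁻¹ * MeasureTheory.integral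
      (MeasureTheory.volume.restrict (Set.Ioi (0:ℝ))) (fun t : ℝ => Real.exp (-(ν * t)) *
      D.currentCorrelation μT t)) (nhdsWithin (0:ℝ) (Set.Ioi 0)) (nhds κ) → (∀ μ : (N : ℕ) → ℝ → ℝ →
      MeasureTheory.Measure (Literature.MathematicalPhysics.KineticTheory.HeatConduction.PhaseSpace N),
      (∀ (N : ℕ) (T_L T_R : ℝ), 0 < T_L → 0 < T_R →
      (Literature.MathematicalPhysics.KineticTheory.HeatConduction.pinnedChain ω₂ lam β γ).IsSteadyState
      N T_L T_R (μ N T_L T_R)) → ∀ Dn : ℕ → ℝ, (∀ N : ℕ, Filter.Tendsto (fun δ : ℝ =>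
      (Literature.MathematicalPhysics.KineticTheory.HeatConduction.pinnedChain ω₂ lam β γ).totalCurrent
      (μ N (T + δ / 2) (T - δ / 2)) / δ) (nhdsWithin 0 {(0 : ℝ)}ᶜ) (nhds (Dn N))) → Filter.Tendsto Dn
      Filter.atTop (nhds κ)) → (∃ μ : (N : ℕ) → ℝ → ℝ → MeasureTheory.Measure
      (Literature.MathematicalPhysics.KineticTheory.HeatConduction.PhaseSpace N), (∀ (N : ℕ) (T_L T_R :
      ℝ), 0 < T_L → 0 < T_R → (Literature.MathematicalPhysics.KineticTheory.HeatConduction.pinnedChain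
      ω₂ lam β γ).IsSteadyState N T_L T_R (μ N T_L T_R)) ∧ ∃ Dn : ℕ → ℝ, ∀ N : ℕ, Filter.Tendsto (fun δ
      : ℝ => (Literature.MathematicalPhysics.KineticTheory.HeatConduction.pinnedChain ω₂ lam β
      γ).totalCurrent (μ N (T + δ / 2) (T - δ / 2)) / δ) (nhdsWithin 0 {(0 : ℝ)}ᶜ) (nhds (Dn N))) →
    let F : ℕ → ℝ → ℝ := fun N ν =>
      MeasureTheory.integral (MeasureTheory.volume.restrict (Set.Ioi (0:ℝ))) (fun t : ℝ =>
        Real.exp (-(ν * t)) *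
          ∫ z, (∑ i : Fin N, (Literature.MathematicalPhysics.KineticTheory.HeatConduction.pinnedChain ω₂ lam β γ).bondCurrent N i z) *
            (∫ y, (∑ i : Fin N, (Literature.MathematicalPhysics.KineticTheory.HeatConduction.pinnedChain ω₂ lam β γ).bondCurrent N i y) ∂((Literature.MathematicalPhysics.KineticTheory.HeatConduction.pinnedChain ω₂ lam β γ).transitionKernel N T T t.toNNReal z))
            ∂((Literature.MathematicalPhysics.KineticTheory.HeatConduction.pinnedChain ω₂ lam β γ).gibbsMeasure N T));
    ∀ ε : ℝ, 0 < ε → ∃ ν₀ : ℝ, 0 < ν₀ ∧ ∀ ν : ℝ, 0 < ν → ν ≤ ν₀ → ∃ N₀ : ℕ, ∀ N : ℕ, N₀ ≤ N →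
      Filter.Eventually (fun ν' : ℝ => F N ν - F N ν' ≤ ε * (N : ℝ)) (nhdsWithin (0:ℝ) (Set.Ioi 0)) := by
  intro ω₂ lam β γ hω hl hβ hγ hU T hT μT D κ hG hS hss hP hAC hκ hAbel hTL hex
  obtain ⟨μ, hμ, Dn, hD⟩ := hex
  have hK' : ∀ N : ℕ, IntegrableOn (cN ω₂ lam β γ T N) (Ioi 0) ∧
      ((N : ℝ) - 1) * T ^ 2 * Dn N = ∫ t in Ioi (0 : ℝ), cN ω₂ lam β γ T N t :=
    fun N => hK ω₂ lam β γ hω hl hβ hγ hU μ hμ T hT N (Dn N) (hD N)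
  have hDC : ∀ N : ℕ, Tendsto (FN ω₂ lam β γ T N) (𝓝[>] 0) (𝓝 (((N : ℝ) - 1) * T ^ 2 * Dn N)) := by
    intro N
    rw [(hK' N).2]
    exact RealAnalysis.tendsto_laplace_zero (hK' N).1
  obtain ⟨ν₂, hν₂, hmatch⟩ := hM ω₂ lam β γ hω hl hβ hγ T hT μT D κ hG hS hss hP hAC hκ hAbel
  have hT2 : (T ^ 2) ≠ 0 := by positivity
  have hA : Tendsto (fun ν : ℝ => ∫ t in Ioi (0 : ℝ), Real.exp (-(ν * t)) * D.currentCorrelation μT t)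
      (𝓝[>] 0) (𝓝 (T ^ 2 * κ)) := by
    have h := hAbel.const_mul (T ^ 2)
    refine h.congr' (Eventually.of_forall fun ν => ?_)
    simp only
    rw [← mul_assoc, mul_inv_cancel₀ hT2, one_mul]
  have hDn : Tendsto Dn atTop (𝓝 κ) := hTL μ hμ Dn hD
  have hconv : Tendsto (fun N : ℕ => ((N : ℝ) - 1) * T ^ 2 * Dn N / N) atTop (𝓝 (T ^ 2 * κ)) := by
    have h1 : Tendsto (fun N : ℕ => (1 : ℝ) - 1 / (N : ℝ)) atTop (𝓝 (1 - 0)) :=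
      tendsto_const_nhds.sub tendsto_one_div_atTop_nhds_zero_nat
    have h2 := (hDn.const_mul (T ^ 2)).mul h1
    rw [sub_zero, mul_one] at h2
    refine h2.congr' ?_
    filter_upwards [eventually_gt_atTop 0] with N hN
    have hN0 : (N : ℝ) ≠ 0 := by positivity
    field_simp
  exact RealAnalysis.notch_of_limit (FN ω₂ lam β γ T) (fun N => ((N : ℝ) - 1) * T ^ 2 * Dn N)
    (fun ν => ∫ t in Ioi (0 : ℝ), Real.exp (-(ν * t)) * D.currentCorrelation μT t) (T ^ 2 * κ) ν₂ hν₂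
    (fun ν hν => hmatch ν hν.1 hν.2) hA hDC hconv

end Summit.AtomisticToContinuum.FouriersLaw.Cruxes.AbelThermodynamicLimit.FeketeAtEveryLaplaceFrequency

end
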